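import Literature.AlgebraicGeometry.HodgeTheory.RibetTypeSeventyNinefoldPowersHodgeClasses
import Literature.AlgebraicGeometry.Motives.HodgeThetaSubalgebraUnitaryNineSeventyCore
import Literature.AlgebraicGeometry.Motives.HodgeThetaSubalgebraUnitaryTenSixtyNineCore
import Literature.AlgebraicGeometry.Motives.HodgeThetaSubalgebraUnitaryFourteenSixtyFiveCore
import Literature.AlgebraicGeometry.Motives.HodgeThetaSubalgebraUnitaryFifteenSixtyFourCore
import Literature.AlgebraicGeometry.Motives.HodgeThetaSubalgebraUnitarySixteenSixtyThreeCore
import Literature.AlgebraicGeometry.Motives.HodgeThetaSubalgebraUnitarySeventeenSixtyTwoCore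
import Literature.AlgebraicGeometry.Motives.HodgeThetaSubalgebraUnitaryNineteenSixtyCore
import Literature.AlgebraicGeometry.Motives.HodgeThetaSubalgebraUnitaryTwentyOneFiftyEightCore
import Literature.AlgebraicGeometry.Motives.HodgeThetaSubalgebraUnitaryTwentyTwoFiftySevenCore
import Literature.AlgebraicGeometry.Motives.HodgeThetaSubalgebraUnitaryTwentyThreeFiftySixCore
import Literature.AlgebraicGeometry.Motives.HodgeThetaSubalgebraUnitaryTwentyFourFiftyFiveCore
import Literature.AlgebraicGeometry.Motives.HodgeThetaSubalgebraUnitaryTwentyFiveFiftyFourCore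
import Literature.AlgebraicGeometry.Motives.HodgeThetaSubalgebraUnitaryTwentySevenFiftyTwoCore
import Literature.AlgebraicGeometry.Motives.HodgeThetaSubalgebraUnitaryTwentyEightFiftyOneCore
import Literature.AlgebraicGeometry.Motives.HodgeThetaSubalgebraUnitaryTwentyNineFiftyCore
import Literature.AlgebraicGeometry.Motives.HodgeThetaSubalgebraUnitaryThirtyFortyNineCore
import Literature.AlgebraicGeometry.Motives.HodgeThetaSubalgebraUnitaryThirtyOneFortyEightCore
import Literature.AlgebraicGeometry.Motives.HodgeThetaSubalgebraUnitaryThirtyThreeFortySixCore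
import Literature.AlgebraicGeometry.Motives.HodgeThetaSubalgebraUnitaryThirtyFourFortyFiveCore
import Literature.AlgebraicGeometry.Motives.HodgeThetaSubalgebraUnitaryThirtyFiveFortyFourCore
import Literature.AlgebraicGeometry.Motives.HodgeThetaSubalgebraUnitaryThirtySevenFortyTwoCore
import Literature.AlgebraicGeometry.Motives.HodgeThetaSubalgebraUnitaryThirtyNineFortyCore
import HarnessLib

/-!
# Hodge classes on all powers of abelian varieties of Ribet type `(9, 70)`, `(10, 69)`, `(14, 65)`, `(15, 64)`, `(16, 63)`, `(17, 62)`, `(19, 60)`, `(21, 58)`, `(22, 57)`, `(23, 56)`, `(24, 55)`, `(25, 54)`, `(27, 52)`, `(28, 51)`, `(29, 50)`, `(30, 49)`, `(31, 48)`, `(33, 46)`, `(34, 45)`, `(35, 44)`, `(37, 42)`, `(39, 40)`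
# are generated by divisor classes (Ribet 1983 Thm. 3 at these multiplicities, by the MINIMAL-RANK method —
# UNCONDITIONAL); EVERY SIMPLE COMPLEX ABELIAN 79-FOLD WITH `End⁰ ≠ ℚ`

Family `hodge`, layer `Literature/AlgebraicGeometry/HodgeTheory`. Research context: cell `pub-hodge-ring2` (HONEST
FRAMING: research route conditional on HC_CM; not a corollary; Q11.4-sentence-2 already refuted in dim ≥ 3),
Literature lane gen 89. UNCONDITIONAL for the class of abelian varieties it names; theorems only, no definition, no
named fact (D-0026), no `sorry`. The CELLS of the generic assembly `RibetTypeOfCoreSmulPowersHodgeClasses` at the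
minimal-rank cores `Unitary….eq_top_of_smul` of the eleven `p = 79` cells with bad raising ranks (settled rank by rank:
a full small Levi algebra and lifts killed in the large one, two pencils, exclusive Levi profiles, TOOL C, the
orthogonal-chain count `UnitaryOrthogonalChain.false_of_constProfile(_pos)`, constant-rank sub-Levi lemmas, the mirror
`−Θ` and raising-rank sub-families), and the conclusion of the census `isDivisorGenerated_powSucc_of_isSimple_seventyninefold`:
with all eleven residual `k`-signatures `{9, 70}`, `{10, 69}`, `{14, 65}`, `{15, 64}`, `{16, 63}`, `{17, 62}`, `{19, 60}`, `{21, 58}`, `{22, 57}`, `{23, 56}`, `{24, 55}`, `{25, 54}`, `{27, 52}`, `{28, 51}`, `{29, 50}`, `{30, 49}`, `{31, 48}`, `{33, 46}`, `{34, 45}`, `{35, 44}`, `{37, 42}`, `{39, 40}` supplied, every simple complex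
abelian `79`-fold with `End⁰ ≠ ℚ` has `B• = D•` and the Hodge conjecture on all powers — `p = 79` COMPLETE, as
`p = 17, …, 43` before it (`RibetTypeTwentyOneTwentyTwoPowersHodgeClasses`).

THE PRINTED THEOREM. Ribet, Amer. J. Math. 105 (1983), Thm. 3 = Gordon's survey Thm. 6.3 (3) [held
`paper:arxiv-alg-geom_9709030` p. 18]: for an abelian variety `A` with `End⁰(A)` an imaginary quadratic field `K` acting
with relatively prime multiplicities `(n′, n″)`, `Hg(A) = Lf(A)` and the Hodge ring of every power of `A` is generated by
divisors (ibid. Thm. 6.2 = Ribet Thm. 0).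

* §1 the cells `(9, 70)`, `(10, 69)`, `(14, 65)`, `(15, 64)`, `(16, 63)`, `(17, 62)`, `(19, 60)`, `(21, 58)`, `(22, 57)`, `(23, 56)`, `(24, 55)`, `(25, 54)`, `(27, 52)`, `(28, 51)`, `(29, 50)`, `(30, 49)`, `(31, 48)`, `(33, 46)`, `(34, 45)`, `(35, 44)`, `(37, 42)`, `(39, 40)` (and mirrors), the Hodge conjecture for these
  powers, 79-FOLDS of these signatures.
* §2 `isDivisorGenerated_powSucc_of_isSimple_seventyninefold'` (granted only `End⁰ = ℚ`),
  `isDivisorGenerated_powSucc_of_isSimple_seventyninefold_of_finrank_endAlgebra_ne_one`,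
  `hodgeConjectureFor_powSucc_of_isSimple_seventyninefold_of_finrank_endAlgebra_ne_one`.

## References
* [Ribet1983] K. A. Ribet, Amer. J. Math. 105 (1983), Thm. 0 and Thm. 3.
* [Gordon1997] B. B. Gordon, *A survey of the Hodge conjecture for abelian varieties*, Thm. 6.3 (3) and Corollary.
* [MoonenZarhin1999LowDim] B. Moonen, Yu. Zarhin, Math. Ann. 315 (1999), §2 (2.4), Thm. (2.7).
* [Deligne2000] P. Deligne, *The Hodge conjecture* (Clay, 2000), §1.
-/

noncomputable section

open CategoryTheory Module

namespace Literature.AlgebraicGeometry.HodgeTheory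

open Literature.AlgebraicGeometry.Motives
open Literature.AlgebraicGeometry.Motives.HodgeStructure

section Cells

/-- **Ribet 1983 Thm. 3 at `(n′, n″) = (9, 70)` — UNCONDITIONAL** (core `UnitaryNineSeventy.eq_top_of_smul`).
[cite: Ribet1983, Thm. 0 and Thm. 3] [cite: Gordon1997, Thm. 6.3 (3) and Corollary] -/
theorem AbelianVariety.isDivisorGenerated_powSucc_of_ribetTypeNineSeventy (A : AbelianVariety ℂ) (φ : A ⟶ A)
    {d : ℕ} (hd : 0 < d) (hφ : φ ≫ φ = -(d • 𝟙 A)) (hE2 : Module.finrank ℚ A.endAlgebra = 2)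
    (h9 : eigenMultiplicity A φ (Complex.I * (Real.sqrt d : ℂ)) = 9)
    (h70 : eigenMultiplicity A φ (-(Complex.I * (Real.sqrt d : ℂ))) = 70) (N : ℕ) :
    IsDivisorGenerated (A.powSucc N) := by
  refine AbelianVariety.isDivisorGenerated_powSucc_of_ribetType_ofCoreSmul A φ hd hφ hE2 (by omega) (by omega) ?_ N
  intro W' _ _ _ 𝔊 ι P' Q' s hbr hirr hι hιι hP' hQ' hfinP' hfinQ' hadd hsmul hsymm hPQ hdefP hdefQ hadj
  exact UnitaryNineSeventy.eq_top_of_smul hbr hirr hι hιι hP' hQ' (by rw [hfinP', h9]) (by rw [hfinQ', h70]) hadd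
    hsmul hsymm hPQ hdefP hdefQ hadj

/-- The mirror: `n_{i√d}(φ) = 70`, `n_{−i√d}(φ) = 9` (core `UnitaryNineSeventy.eq_top_of_smul'`).
[cite: Ribet1983, Thm. 0 and Thm. 3] [cite: Gordon1997, Thm. 6.3 (3) and Corollary] -/
theorem AbelianVariety.isDivisorGenerated_powSucc_of_ribetTypeNineSeventy' (A : AbelianVariety ℂ) (φ : A ⟶ A)
    {d : ℕ} (hd : 0 < d) (hφ : φ ≫ φ = -(d • 𝟙 A)) (hE2 : Module.finrank ℚ A.endAlgebra = 2)
    (h70 : eigenMultiplicity A φ (Complex.I * (Real.sqrt d : ℂ)) = 70)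
    (h9 : eigenMultiplicity A φ (-(Complex.I * (Real.sqrt d : ℂ))) = 9) (N : ℕ) :
    IsDivisorGenerated (A.powSucc N) := by
  refine AbelianVariety.isDivisorGenerated_powSucc_of_ribetType_ofCoreSmul A φ hd hφ hE2 (by omega) (by omega) ?_ N
  intro W' _ _ _ 𝔊 ι P' Q' s hbr hirr hι hιι hP' hQ' hfinP' hfinQ' hadd hsmul hsymm hPQ hdefP hdefQ hadj
  exact UnitaryNineSeventy.eq_top_of_smul' hbr hirr hι hιι hP' hQ' (by rw [hfinP', h70]) (by rw [hfinQ', h9])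
    hadd hsmul hsymm hPQ hdefP hdefQ hadj

/-- **The Hodge conjecture for all powers `A^{N+1}` of an abelian variety of Ribet type `(9, 70)` — UNCONDITIONAL.**
[cite: Ribet1983, Thm. 3] [cite: Deligne2000, §1] -/
theorem hodgeConjectureFor_powSucc_of_ribetTypeNineSeventy (A : AbelianVariety ℂ) (φ : A ⟶ A)
    {d : ℕ} (hd : 0 < d) (hφ : φ ≫ φ = -(d • 𝟙 A)) (hE2 : Module.finrank ℚ A.endAlgebra = 2)
    (h9 : eigenMultiplicity A φ (Complex.I * (Real.sqrt d : ℂ)) = 9)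
    (h70 : eigenMultiplicity A φ (-(Complex.I * (Real.sqrt d : ℂ))) = 70) (N : ℕ) :
    HodgeConjectureFor (A.powSucc N).dim (A.powSucc N).X :=
  hodgeConjectureFor_of_isDivisorGenerated _
    (AbelianVariety.isDivisorGenerated_powSucc_of_ribetTypeNineSeventy A φ hd hφ hE2 h9 h70 N)

/-- **79-FOLDS of signature `{9, 70}`: `B• = D•` on all powers — UNCONDITIONAL** (either eigenvalue may carry the `9`).
[cite: Ribet1983, Thm. 0 and Thm. 3] [cite: MoonenZarhin1999LowDim, §2 (2.4)] -/
theorem AbelianVariety.isDivisorGenerated_powSucc_of_seventyninefold_nineSeventy (A : AbelianVariety ℂ)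
    (φ : A ⟶ A) {d : ℕ} (hd : 0 < d) (hφ : φ ≫ φ = -(d • 𝟙 A)) (hE2 : Module.finrank ℚ A.endAlgebra = 2)
    (hX : A.dim = 79)
    (h9 : eigenMultiplicity A φ (Complex.I * (Real.sqrt d : ℂ)) = 9 ∨
      eigenMultiplicity A φ (-(Complex.I * (Real.sqrt d : ℂ))) = 9)
    (N : ℕ) : IsDivisorGenerated (A.powSucc N) := by
  have hsum := eigenMultiplicity_add_eigenMultiplicity_neg_eq_dim A φ hd hφ
  rw [hX] at hsum
  rcases h9 with h | h
  · exact AbelianVariety.isDivisorGenerated_powSucc_of_ribetTypeNineSeventy A φ hd hφ hE2 h (by omega) N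
  · exact AbelianVariety.isDivisorGenerated_powSucc_of_ribetTypeNineSeventy' A φ hd hφ hE2 (by omega) h N

/-- **The Hodge conjecture for all powers of a 79-FOLD of signature `{9, 70}` — UNCONDITIONAL.**
[cite: Ribet1983, Thm. 3] [cite: Deligne2000, §1] -/
theorem hodgeConjectureFor_powSucc_of_seventyninefold_nineSeventy (A : AbelianVariety ℂ)
    (φ : A ⟶ A) {d : ℕ} (hd : 0 < d) (hφ : φ ≫ φ = -(d • 𝟙 A)) (hE2 : Module.finrank ℚ A.endAlgebra = 2)
    (hX : A.dim = 79)
    (h9 : eigenMultiplicity A φ (Complex.I * (Real.sqrt d : ℂ)) = 9 ∨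
      eigenMultiplicity A φ (-(Complex.I * (Real.sqrt d : ℂ))) = 9)
    (N : ℕ) : HodgeConjectureFor (A.powSucc N).dim (A.powSucc N).X :=
  hodgeConjectureFor_of_isDivisorGenerated _
    (AbelianVariety.isDivisorGenerated_powSucc_of_seventyninefold_nineSeventy A φ hd hφ hE2 hX h9 N)

/-- **Ribet 1983 Thm. 3 at `(n′, n″) = (10, 69)` — UNCONDITIONAL** (core `UnitaryTenSixtyNine.eq_top_of_smul`).
[cite: Ribet1983, Thm. 0 and Thm. 3] [cite: Gordon1997, Thm. 6.3 (3) and Corollary] -/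
theorem AbelianVariety.isDivisorGenerated_powSucc_of_ribetTypeTenSixtyNine (A : AbelianVariety ℂ) (φ : A ⟶ A)
    {d : ℕ} (hd : 0 < d) (hφ : φ ≫ φ = -(d • 𝟙 A)) (hE2 : Module.finrank ℚ A.endAlgebra = 2)
    (h10 : eigenMultiplicity A φ (Complex.I * (Real.sqrt d : ℂ)) = 10)
    (h69 : eigenMultiplicity A φ (-(Complex.I * (Real.sqrt d : ℂ))) = 69) (N : ℕ) :
    IsDivisorGenerated (A.powSucc N) := by
  refine AbelianVariety.isDivisorGenerated_powSucc_of_ribetType_ofCoreSmul A φ hd hφ hE2 (by omega) (by omega) ?_ N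
  intro W' _ _ _ 𝔊 ι P' Q' s hbr hirr hι hιι hP' hQ' hfinP' hfinQ' hadd hsmul hsymm hPQ hdefP hdefQ hadj
  exact UnitaryTenSixtyNine.eq_top_of_smul hbr hirr hι hιι hP' hQ' (by rw [hfinP', h10]) (by rw [hfinQ', h69]) hadd
    hsmul hsymm hPQ hdefP hdefQ hadj

/-- The mirror: `n_{i√d}(φ) = 69`, `n_{−i√d}(φ) = 10` (core `UnitaryTenSixtyNine.eq_top_of_smul'`).
[cite: Ribet1983, Thm. 0 and Thm. 3] [cite: Gordon1997, Thm. 6.3 (3) and Corollary] -/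
theorem AbelianVariety.isDivisorGenerated_powSucc_of_ribetTypeTenSixtyNine' (A : AbelianVariety ℂ) (φ : A ⟶ A)
    {d : ℕ} (hd : 0 < d) (hφ : φ ≫ φ = -(d • 𝟙 A)) (hE2 : Module.finrank ℚ A.endAlgebra = 2)
    (h69 : eigenMultiplicity A φ (Complex.I * (Real.sqrt d : ℂ)) = 69)
    (h10 : eigenMultiplicity A φ (-(Complex.I * (Real.sqrt d : ℂ))) = 10) (N : ℕ) :
    IsDivisorGenerated (A.powSucc N) := by
  refine AbelianVariety.isDivisorGenerated_powSucc_of_ribetType_ofCoreSmul A φ hd hφ hE2 (by omega) (by omega) ?_ N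
  intro W' _ _ _ 𝔊 ι P' Q' s hbr hirr hι hιι hP' hQ' hfinP' hfinQ' hadd hsmul hsymm hPQ hdefP hdefQ hadj
  exact UnitaryTenSixtyNine.eq_top_of_smul' hbr hirr hι hιι hP' hQ' (by rw [hfinP', h69]) (by rw [hfinQ', h10])
    hadd hsmul hsymm hPQ hdefP hdefQ hadj

/-- **The Hodge conjecture for all powers `A^{N+1}` of an abelian variety of Ribet type `(10, 69)` — UNCONDITIONAL.**
[cite: Ribet1983, Thm. 3] [cite: Deligne2000, §1] -/
theorem hodgeConjectureFor_powSucc_of_ribetTypeTenSixtyNine (A : AbelianVariety ℂ) (φ : A ⟶ A)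
    {d : ℕ} (hd : 0 < d) (hφ : φ ≫ φ = -(d • 𝟙 A)) (hE2 : Module.finrank ℚ A.endAlgebra = 2)
    (h10 : eigenMultiplicity A φ (Complex.I * (Real.sqrt d : ℂ)) = 10)
    (h69 : eigenMultiplicity A φ (-(Complex.I * (Real.sqrt d : ℂ))) = 69) (N : ℕ) :
    HodgeConjectureFor (A.powSucc N).dim (A.powSucc N).X :=
  hodgeConjectureFor_of_isDivisorGenerated _
    (AbelianVariety.isDivisorGenerated_powSucc_of_ribetTypeTenSixtyNine A φ hd hφ hE2 h10 h69 N)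

/-- **79-FOLDS of signature `{10, 69}`: `B• = D•` on all powers — UNCONDITIONAL** (either eigenvalue may carry the `10`).
[cite: Ribet1983, Thm. 0 and Thm. 3] [cite: MoonenZarhin1999LowDim, §2 (2.4)] -/
theorem AbelianVariety.isDivisorGenerated_powSucc_of_seventyninefold_tenSixtyNine (A : AbelianVariety ℂ)
    (φ : A ⟶ A) {d : ℕ} (hd : 0 < d) (hφ : φ ≫ φ = -(d • 𝟙 A)) (hE2 : Module.finrank ℚ A.endAlgebra = 2)
    (hX : A.dim = 79)
    (h10 : eigenMultiplicity A φ (Complex.I * (Real.sqrt d : ℂ)) = 10 ∨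
      eigenMultiplicity A φ (-(Complex.I * (Real.sqrt d : ℂ))) = 10)
    (N : ℕ) : IsDivisorGenerated (A.powSucc N) := by
  have hsum := eigenMultiplicity_add_eigenMultiplicity_neg_eq_dim A φ hd hφ
  rw [hX] at hsum
  rcases h10 with h | h
  · exact AbelianVariety.isDivisorGenerated_powSucc_of_ribetTypeTenSixtyNine A φ hd hφ hE2 h (by omega) N
  · exact AbelianVariety.isDivisorGenerated_powSucc_of_ribetTypeTenSixtyNine' A φ hd hφ hE2 (by omega) h N

/-- **The Hodge conjecture for all powers of a 79-FOLD of signature `{10, 69}` — UNCONDITIONAL.**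
[cite: Ribet1983, Thm. 3] [cite: Deligne2000, §1] -/
theorem hodgeConjectureFor_powSucc_of_seventyninefold_tenSixtyNine (A : AbelianVariety ℂ)
    (φ : A ⟶ A) {d : ℕ} (hd : 0 < d) (hφ : φ ≫ φ = -(d • 𝟙 A)) (hE2 : Module.finrank ℚ A.endAlgebra = 2)
    (hX : A.dim = 79)
    (h10 : eigenMultiplicity A φ (Complex.I * (Real.sqrt d : ℂ)) = 10 ∨
      eigenMultiplicity A φ (-(Complex.I * (Real.sqrt d : ℂ))) = 10)
    (N : ℕ) : HodgeConjectureFor (A.powSucc N).dim (A.powSucc N).X :=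
  hodgeConjectureFor_of_isDivisorGenerated _
    (AbelianVariety.isDivisorGenerated_powSucc_of_seventyninefold_tenSixtyNine A φ hd hφ hE2 hX h10 N)

/-- **Ribet 1983 Thm. 3 at `(n′, n″) = (14, 65)` — UNCONDITIONAL** (core `UnitaryFourteenSixtyFive.eq_top_of_smul`).
[cite: Ribet1983, Thm. 0 and Thm. 3] [cite: Gordon1997, Thm. 6.3 (3) and Corollary] -/
theorem AbelianVariety.isDivisorGenerated_powSucc_of_ribetTypeFourteenSixtyFive (A : AbelianVariety ℂ) (φ : A ⟶ A)
    {d : ℕ} (hd : 0 < d) (hφ : φ ≫ φ = -(d • 𝟙 A)) (hE2 : Module.finrank ℚ A.endAlgebra = 2)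
    (h14 : eigenMultiplicity A φ (Complex.I * (Real.sqrt d : ℂ)) = 14)
    (h65 : eigenMultiplicity A φ (-(Complex.I * (Real.sqrt d : ℂ))) = 65) (N : ℕ) :
    IsDivisorGenerated (A.powSucc N) := by
  refine AbelianVariety.isDivisorGenerated_powSucc_of_ribetType_ofCoreSmul A φ hd hφ hE2 (by omega) (by omega) ?_ N
  intro W' _ _ _ 𝔊 ι P' Q' s hbr hirr hι hιι hP' hQ' hfinP' hfinQ' hadd hsmul hsymm hPQ hdefP hdefQ hadj
  exact UnitaryFourteenSixtyFive.eq_top_of_smul hbr hirr hι hιι hP' hQ' (by rw [hfinP', h14]) (by rw [hfinQ', h65]) hadd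
    hsmul hsymm hPQ hdefP hdefQ hadj

/-- The mirror: `n_{i√d}(φ) = 65`, `n_{−i√d}(φ) = 14` (core `UnitaryFourteenSixtyFive.eq_top_of_smul'`).
[cite: Ribet1983, Thm. 0 and Thm. 3] [cite: Gordon1997, Thm. 6.3 (3) and Corollary] -/
theorem AbelianVariety.isDivisorGenerated_powSucc_of_ribetTypeFourteenSixtyFive' (A : AbelianVariety ℂ) (φ : A ⟶ A)
    {d : ℕ} (hd : 0 < d) (hφ : φ ≫ φ = -(d • 𝟙 A)) (hE2 : Module.finrank ℚ A.endAlgebra = 2)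
    (h65 : eigenMultiplicity A φ (Complex.I * (Real.sqrt d : ℂ)) = 65)
    (h14 : eigenMultiplicity A φ (-(Complex.I * (Real.sqrt d : ℂ))) = 14) (N : ℕ) :
    IsDivisorGenerated (A.powSucc N) := by
  refine AbelianVariety.isDivisorGenerated_powSucc_of_ribetType_ofCoreSmul A φ hd hφ hE2 (by omega) (by omega) ?_ N
  intro W' _ _ _ 𝔊 ι P' Q' s hbr hirr hι hιι hP' hQ' hfinP' hfinQ' hadd hsmul hsymm hPQ hdefP hdefQ hadj
  exact UnitaryFourteenSixtyFive.eq_top_of_smul' hbr hirr hι hιι hP' hQ' (by rw [hfinP', h65]) (by rw [hfinQ', h14])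
    hadd hsmul hsymm hPQ hdefP hdefQ hadj

/-- **The Hodge conjecture for all powers `A^{N+1}` of an abelian variety of Ribet type `(14, 65)` — UNCONDITIONAL.**
[cite: Ribet1983, Thm. 3] [cite: Deligne2000, §1] -/
theorem hodgeConjectureFor_powSucc_of_ribetTypeFourteenSixtyFive (A : AbelianVariety ℂ) (φ : A ⟶ A)
    {d : ℕ} (hd : 0 < d) (hφ : φ ≫ φ = -(d • 𝟙 A)) (hE2 : Module.finrank ℚ A.endAlgebra = 2)
    (h14 : eigenMultiplicity A φ (Complex.I * (Real.sqrt d : ℂ)) = 14)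
    (h65 : eigenMultiplicity A φ (-(Complex.I * (Real.sqrt d : ℂ))) = 65) (N : ℕ) :
    HodgeConjectureFor (A.powSucc N).dim (A.powSucc N).X :=
  hodgeConjectureFor_of_isDivisorGenerated _
    (AbelianVariety.isDivisorGenerated_powSucc_of_ribetTypeFourteenSixtyFive A φ hd hφ hE2 h14 h65 N)

/-- **79-FOLDS of signature `{14, 65}`: `B• = D•` on all powers — UNCONDITIONAL** (either eigenvalue may carry the `14`).
[cite: Ribet1983, Thm. 0 and Thm. 3] [cite: MoonenZarhin1999LowDim, §2 (2.4)] -/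
theorem AbelianVariety.isDivisorGenerated_powSucc_of_seventyninefold_fourteenSixtyFive (A : AbelianVariety ℂ)
    (φ : A ⟶ A) {d : ℕ} (hd : 0 < d) (hφ : φ ≫ φ = -(d • 𝟙 A)) (hE2 : Module.finrank ℚ A.endAlgebra = 2)
    (hX : A.dim = 79)
    (h14 : eigenMultiplicity A φ (Complex.I * (Real.sqrt d : ℂ)) = 14 ∨
      eigenMultiplicity A φ (-(Complex.I * (Real.sqrt d : ℂ))) = 14)
    (N : ℕ) : IsDivisorGenerated (A.powSucc N) := by
  have hsum := eigenMultiplicity_add_eigenMultiplicity_neg_eq_dim A φ hd hφ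
  rw [hX] at hsum
  rcases h14 with h | h
  · exact AbelianVariety.isDivisorGenerated_powSucc_of_ribetTypeFourteenSixtyFive A φ hd hφ hE2 h (by omega) N
  · exact AbelianVariety.isDivisorGenerated_powSucc_of_ribetTypeFourteenSixtyFive' A φ hd hφ hE2 (by omega) h N

/-- **The Hodge conjecture for all powers of a 79-FOLD of signature `{14, 65}` — UNCONDITIONAL.**
[cite: Ribet1983, Thm. 3] [cite: Deligne2000, §1] -/
theorem hodgeConjectureFor_powSucc_of_seventyninefold_fourteenSixtyFive (A : AbelianVariety ℂ)
    (φ : A ⟶ A) {d : ℕ} (hd : 0 < d) (hφ : φ ≫ φ = -(d • 𝟙 A)) (hE2 : Module.finrank ℚ A.endAlgebra = 2)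
    (hX : A.dim = 79)
    (h14 : eigenMultiplicity A φ (Complex.I * (Real.sqrt d : ℂ)) = 14 ∨
      eigenMultiplicity A φ (-(Complex.I * (Real.sqrt d : ℂ))) = 14)
    (N : ℕ) : HodgeConjectureFor (A.powSucc N).dim (A.powSucc N).X :=
  hodgeConjectureFor_of_isDivisorGenerated _
    (AbelianVariety.isDivisorGenerated_powSucc_of_seventyninefold_fourteenSixtyFive A φ hd hφ hE2 hX h14 N)

/-- **Ribet 1983 Thm. 3 at `(n′, n″) = (15, 64)` — UNCONDITIONAL** (core `UnitaryFifteenSixtyFour.eq_top_of_smul`).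
[cite: Ribet1983, Thm. 0 and Thm. 3] [cite: Gordon1997, Thm. 6.3 (3) and Corollary] -/
theorem AbelianVariety.isDivisorGenerated_powSucc_of_ribetTypeFifteenSixtyFour (A : AbelianVariety ℂ) (φ : A ⟶ A)
    {d : ℕ} (hd : 0 < d) (hφ : φ ≫ φ = -(d • 𝟙 A)) (hE2 : Module.finrank ℚ A.endAlgebra = 2)
    (h15 : eigenMultiplicity A φ (Complex.I * (Real.sqrt d : ℂ)) = 15)
    (h64 : eigenMultiplicity A φ (-(Complex.I * (Real.sqrt d : ℂ))) = 64) (N : ℕ) :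
    IsDivisorGenerated (A.powSucc N) := by
  refine AbelianVariety.isDivisorGenerated_powSucc_of_ribetType_ofCoreSmul A φ hd hφ hE2 (by omega) (by omega) ?_ N
  intro W' _ _ _ 𝔊 ι P' Q' s hbr hirr hι hιι hP' hQ' hfinP' hfinQ' hadd hsmul hsymm hPQ hdefP hdefQ hadj
  exact UnitaryFifteenSixtyFour.eq_top_of_smul hbr hirr hι hιι hP' hQ' (by rw [hfinP', h15]) (by rw [hfinQ', h64]) hadd
    hsmul hsymm hPQ hdefP hdefQ hadj

/-- The mirror: `n_{i√d}(φ) = 64`, `n_{−i√d}(φ) = 15` (core `UnitaryFifteenSixtyFour.eq_top_of_smul'`).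
[cite: Ribet1983, Thm. 0 and Thm. 3] [cite: Gordon1997, Thm. 6.3 (3) and Corollary] -/
theorem AbelianVariety.isDivisorGenerated_powSucc_of_ribetTypeFifteenSixtyFour' (A : AbelianVariety ℂ) (φ : A ⟶ A)
    {d : ℕ} (hd : 0 < d) (hφ : φ ≫ φ = -(d • 𝟙 A)) (hE2 : Module.finrank ℚ A.endAlgebra = 2)
    (h64 : eigenMultiplicity A φ (Complex.I * (Real.sqrt d : ℂ)) = 64)
    (h15 : eigenMultiplicity A φ (-(Complex.I * (Real.sqrt d : ℂ))) = 15) (N : ℕ) :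
    IsDivisorGenerated (A.powSucc N) := by
  refine AbelianVariety.isDivisorGenerated_powSucc_of_ribetType_ofCoreSmul A φ hd hφ hE2 (by omega) (by omega) ?_ N
  intro W' _ _ _ 𝔊 ι P' Q' s hbr hirr hι hιι hP' hQ' hfinP' hfinQ' hadd hsmul hsymm hPQ hdefP hdefQ hadj
  exact UnitaryFifteenSixtyFour.eq_top_of_smul' hbr hirr hι hιι hP' hQ' (by rw [hfinP', h64]) (by rw [hfinQ', h15])
    hadd hsmul hsymm hPQ hdefP hdefQ hadj

/-- **The Hodge conjecture for all powers `A^{N+1}` of an abelian variety of Ribet type `(15, 64)` — UNCONDITIONAL.**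
[cite: Ribet1983, Thm. 3] [cite: Deligne2000, §1] -/
theorem hodgeConjectureFor_powSucc_of_ribetTypeFifteenSixtyFour (A : AbelianVariety ℂ) (φ : A ⟶ A)
    {d : ℕ} (hd : 0 < d) (hφ : φ ≫ φ = -(d • 𝟙 A)) (hE2 : Module.finrank ℚ A.endAlgebra = 2)
    (h15 : eigenMultiplicity A φ (Complex.I * (Real.sqrt d : ℂ)) = 15)
    (h64 : eigenMultiplicity A φ (-(Complex.I * (Real.sqrt d : ℂ))) = 64) (N : ℕ) :
    HodgeConjectureFor (A.powSucc N).dim (A.powSucc N).X :=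
  hodgeConjectureFor_of_isDivisorGenerated _
    (AbelianVariety.isDivisorGenerated_powSucc_of_ribetTypeFifteenSixtyFour A φ hd hφ hE2 h15 h64 N)

/-- **79-FOLDS of signature `{15, 64}`: `B• = D•` on all powers — UNCONDITIONAL** (either eigenvalue may carry the `15`).
[cite: Ribet1983, Thm. 0 and Thm. 3] [cite: MoonenZarhin1999LowDim, §2 (2.4)] -/
theorem AbelianVariety.isDivisorGenerated_powSucc_of_seventyninefold_fifteenSixtyFour (A : AbelianVariety ℂ)
    (φ : A ⟶ A) {d : ℕ} (hd : 0 < d) (hφ : φ ≫ φ = -(d • 𝟙 A)) (hE2 : Module.finrank ℚ A.endAlgebra = 2)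
    (hX : A.dim = 79)
    (h15 : eigenMultiplicity A φ (Complex.I * (Real.sqrt d : ℂ)) = 15 ∨
      eigenMultiplicity A φ (-(Complex.I * (Real.sqrt d : ℂ))) = 15)
    (N : ℕ) : IsDivisorGenerated (A.powSucc N) := by
  have hsum := eigenMultiplicity_add_eigenMultiplicity_neg_eq_dim A φ hd hφ
  rw [hX] at hsum
  rcases h15 with h | h
  · exact AbelianVariety.isDivisorGenerated_powSucc_of_ribetTypeFifteenSixtyFour A φ hd hφ hE2 h (by omega) N
  · exact AbelianVariety.isDivisorGenerated_powSucc_of_ribetTypeFifteenSixtyFour' A φ hd hφ hE2 (by omega) h N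

/-- **The Hodge conjecture for all powers of a 79-FOLD of signature `{15, 64}` — UNCONDITIONAL.**
[cite: Ribet1983, Thm. 3] [cite: Deligne2000, §1] -/
theorem hodgeConjectureFor_powSucc_of_seventyninefold_fifteenSixtyFour (A : AbelianVariety ℂ)
    (φ : A ⟶ A) {d : ℕ} (hd : 0 < d) (hφ : φ ≫ φ = -(d • 𝟙 A)) (hE2 : Module.finrank ℚ A.endAlgebra = 2)
    (hX : A.dim = 79)
    (h15 : eigenMultiplicity A φ (Complex.I * (Real.sqrt d : ℂ)) = 15 ∨
      eigenMultiplicity A φ (-(Complex.I * (Real.sqrt d : ℂ))) = 15)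
    (N : ℕ) : HodgeConjectureFor (A.powSucc N).dim (A.powSucc N).X :=
  hodgeConjectureFor_of_isDivisorGenerated _
    (AbelianVariety.isDivisorGenerated_powSucc_of_seventyninefold_fifteenSixtyFour A φ hd hφ hE2 hX h15 N)

/-- **Ribet 1983 Thm. 3 at `(n′, n″) = (16, 63)` — UNCONDITIONAL** (core `UnitarySixteenSixtyThree.eq_top_of_smul`).
[cite: Ribet1983, Thm. 0 and Thm. 3] [cite: Gordon1997, Thm. 6.3 (3) and Corollary] -/
theorem AbelianVariety.isDivisorGenerated_powSucc_of_ribetTypeSixteenSixtyThree (A : AbelianVariety ℂ) (φ : A ⟶ A)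
    {d : ℕ} (hd : 0 < d) (hφ : φ ≫ φ = -(d • 𝟙 A)) (hE2 : Module.finrank ℚ A.endAlgebra = 2)
    (h16 : eigenMultiplicity A φ (Complex.I * (Real.sqrt d : ℂ)) = 16)
    (h63 : eigenMultiplicity A φ (-(Complex.I * (Real.sqrt d : ℂ))) = 63) (N : ℕ) :
    IsDivisorGenerated (A.powSucc N) := by
  refine AbelianVariety.isDivisorGenerated_powSucc_of_ribetType_ofCoreSmul A φ hd hφ hE2 (by omega) (by omega) ?_ N
  intro W' _ _ _ 𝔊 ι P' Q' s hbr hirr hι hιι hP' hQ' hfinP' hfinQ' hadd hsmul hsymm hPQ hdefP hdefQ hadj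
  exact UnitarySixteenSixtyThree.eq_top_of_smul hbr hirr hι hιι hP' hQ' (by rw [hfinP', h16]) (by rw [hfinQ', h63]) hadd
    hsmul hsymm hPQ hdefP hdefQ hadj

/-- The mirror: `n_{i√d}(φ) = 63`, `n_{−i√d}(φ) = 16` (core `UnitarySixteenSixtyThree.eq_top_of_smul'`).
[cite: Ribet1983, Thm. 0 and Thm. 3] [cite: Gordon1997, Thm. 6.3 (3) and Corollary] -/
theorem AbelianVariety.isDivisorGenerated_powSucc_of_ribetTypeSixteenSixtyThree' (A : AbelianVariety ℂ) (φ : A ⟶ A)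
    {d : ℕ} (hd : 0 < d) (hφ : φ ≫ φ = -(d • 𝟙 A)) (hE2 : Module.finrank ℚ A.endAlgebra = 2)
    (h63 : eigenMultiplicity A φ (Complex.I * (Real.sqrt d : ℂ)) = 63)
    (h16 : eigenMultiplicity A φ (-(Complex.I * (Real.sqrt d : ℂ))) = 16) (N : ℕ) :
    IsDivisorGenerated (A.powSucc N) := by
  refine AbelianVariety.isDivisorGenerated_powSucc_of_ribetType_ofCoreSmul A φ hd hφ hE2 (by omega) (by omega) ?_ N
  intro W' _ _ _ 𝔊 ι P' Q' s hbr hirr hι hιι hP' hQ' hfinP' hfinQ' hadd hsmul hsymm hPQ hdefP hdefQ hadj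
  exact UnitarySixteenSixtyThree.eq_top_of_smul' hbr hirr hι hιι hP' hQ' (by rw [hfinP', h63]) (by rw [hfinQ', h16])
    hadd hsmul hsymm hPQ hdefP hdefQ hadj

/-- **The Hodge conjecture for all powers `A^{N+1}` of an abelian variety of Ribet type `(16, 63)` — UNCONDITIONAL.**
[cite: Ribet1983, Thm. 3] [cite: Deligne2000, §1] -/
theorem hodgeConjectureFor_powSucc_of_ribetTypeSixteenSixtyThree (A : AbelianVariety ℂ) (φ : A ⟶ A)
    {d : ℕ} (hd : 0 < d) (hφ : φ ≫ φ = -(d • 𝟙 A)) (hE2 : Module.finrank ℚ A.endAlgebra = 2)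
    (h16 : eigenMultiplicity A φ (Complex.I * (Real.sqrt d : ℂ)) = 16)
    (h63 : eigenMultiplicity A φ (-(Complex.I * (Real.sqrt d : ℂ))) = 63) (N : ℕ) :
    HodgeConjectureFor (A.powSucc N).dim (A.powSucc N).X :=
  hodgeConjectureFor_of_isDivisorGenerated _
    (AbelianVariety.isDivisorGenerated_powSucc_of_ribetTypeSixteenSixtyThree A φ hd hφ hE2 h16 h63 N)

/-- **79-FOLDS of signature `{16, 63}`: `B• = D•` on all powers — UNCONDITIONAL** (either eigenvalue may carry the `16`).
[cite: Ribet1983, Thm. 0 and Thm. 3] [cite: MoonenZarhin1999LowDim, §2 (2.4)] -/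
theorem AbelianVariety.isDivisorGenerated_powSucc_of_seventyninefold_sixteenSixtyThree (A : AbelianVariety ℂ)
    (φ : A ⟶ A) {d : ℕ} (hd : 0 < d) (hφ : φ ≫ φ = -(d • 𝟙 A)) (hE2 : Module.finrank ℚ A.endAlgebra = 2)
    (hX : A.dim = 79)
    (h16 : eigenMultiplicity A φ (Complex.I * (Real.sqrt d : ℂ)) = 16 ∨
      eigenMultiplicity A φ (-(Complex.I * (Real.sqrt d : ℂ))) = 16)
    (N : ℕ) : IsDivisorGenerated (A.powSucc N) := by
  have hsum := eigenMultiplicity_add_eigenMultiplicity_neg_eq_dim A φ hd hφ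
  rw [hX] at hsum
  rcases h16 with h | h
  · exact AbelianVariety.isDivisorGenerated_powSucc_of_ribetTypeSixteenSixtyThree A φ hd hφ hE2 h (by omega) N
  · exact AbelianVariety.isDivisorGenerated_powSucc_of_ribetTypeSixteenSixtyThree' A φ hd hφ hE2 (by omega) h N

/-- **The Hodge conjecture for all powers of a 79-FOLD of signature `{16, 63}` — UNCONDITIONAL.**
[cite: Ribet1983, Thm. 3] [cite: Deligne2000, §1] -/
theorem hodgeConjectureFor_powSucc_of_seventyninefold_sixteenSixtyThree (A : AbelianVariety ℂ)
    (φ : A ⟶ A) {d : ℕ} (hd : 0 < d) (hφ : φ ≫ φ = -(d • 𝟙 A)) (hE2 : Module.finrank ℚ A.endAlgebra = 2)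
    (hX : A.dim = 79)
    (h16 : eigenMultiplicity A φ (Complex.I * (Real.sqrt d : ℂ)) = 16 ∨
      eigenMultiplicity A φ (-(Complex.I * (Real.sqrt d : ℂ))) = 16)
    (N : ℕ) : HodgeConjectureFor (A.powSucc N).dim (A.powSucc N).X :=
  hodgeConjectureFor_of_isDivisorGenerated _
    (AbelianVariety.isDivisorGenerated_powSucc_of_seventyninefold_sixteenSixtyThree A φ hd hφ hE2 hX h16 N)

/-- **Ribet 1983 Thm. 3 at `(n′, n″) = (17, 62)` — UNCONDITIONAL** (core `UnitarySeventeenSixtyTwo.eq_top_of_smul`).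
[cite: Ribet1983, Thm. 0 and Thm. 3] [cite: Gordon1997, Thm. 6.3 (3) and Corollary] -/
theorem AbelianVariety.isDivisorGenerated_powSucc_of_ribetTypeSeventeenSixtyTwo (A : AbelianVariety ℂ) (φ : A ⟶ A)
    {d : ℕ} (hd : 0 < d) (hφ : φ ≫ φ = -(d • 𝟙 A)) (hE2 : Module.finrank ℚ A.endAlgebra = 2)
    (h17 : eigenMultiplicity A φ (Complex.I * (Real.sqrt d : ℂ)) = 17)
    (h62 : eigenMultiplicity A φ (-(Complex.I * (Real.sqrt d : ℂ))) = 62) (N : ℕ) :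
    IsDivisorGenerated (A.powSucc N) := by
  refine AbelianVariety.isDivisorGenerated_powSucc_of_ribetType_ofCoreSmul A φ hd hφ hE2 (by omega) (by omega) ?_ N
  intro W' _ _ _ 𝔊 ι P' Q' s hbr hirr hι hιι hP' hQ' hfinP' hfinQ' hadd hsmul hsymm hPQ hdefP hdefQ hadj
  exact UnitarySeventeenSixtyTwo.eq_top_of_smul hbr hirr hι hιι hP' hQ' (by rw [hfinP', h17]) (by rw [hfinQ', h62]) hadd
    hsmul hsymm hPQ hdefP hdefQ hadj

/-- The mirror: `n_{i√d}(φ) = 62`, `n_{−i√d}(φ) = 17` (core `UnitarySeventeenSixtyTwo.eq_top_of_smul'`).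
[cite: Ribet1983, Thm. 0 and Thm. 3] [cite: Gordon1997, Thm. 6.3 (3) and Corollary] -/
theorem AbelianVariety.isDivisorGenerated_powSucc_of_ribetTypeSeventeenSixtyTwo' (A : AbelianVariety ℂ) (φ : A ⟶ A)
    {d : ℕ} (hd : 0 < d) (hφ : φ ≫ φ = -(d • 𝟙 A)) (hE2 : Module.finrank ℚ A.endAlgebra = 2)
    (h62 : eigenMultiplicity A φ (Complex.I * (Real.sqrt d : ℂ)) = 62)
    (h17 : eigenMultiplicity A φ (-(Complex.I * (Real.sqrt d : ℂ))) = 17) (N : ℕ) :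
    IsDivisorGenerated (A.powSucc N) := by
  refine AbelianVariety.isDivisorGenerated_powSucc_of_ribetType_ofCoreSmul A φ hd hφ hE2 (by omega) (by omega) ?_ N
  intro W' _ _ _ 𝔊 ι P' Q' s hbr hirr hι hιι hP' hQ' hfinP' hfinQ' hadd hsmul hsymm hPQ hdefP hdefQ hadj
  exact UnitarySeventeenSixtyTwo.eq_top_of_smul' hbr hirr hι hιι hP' hQ' (by rw [hfinP', h62]) (by rw [hfinQ', h17])
    hadd hsmul hsymm hPQ hdefP hdefQ hadj

/-- **The Hodge conjecture for all powers `A^{N+1}` of an abelian variety of Ribet type `(17, 62)` — UNCONDITIONAL.**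
[cite: Ribet1983, Thm. 3] [cite: Deligne2000, §1] -/
theorem hodgeConjectureFor_powSucc_of_ribetTypeSeventeenSixtyTwo (A : AbelianVariety ℂ) (φ : A ⟶ A)
    {d : ℕ} (hd : 0 < d) (hφ : φ ≫ φ = -(d • 𝟙 A)) (hE2 : Module.finrank ℚ A.endAlgebra = 2)
    (h17 : eigenMultiplicity A φ (Complex.I * (Real.sqrt d : ℂ)) = 17)
    (h62 : eigenMultiplicity A φ (-(Complex.I * (Real.sqrt d : ℂ))) = 62) (N : ℕ) :
    HodgeConjectureFor (A.powSucc N).dim (A.powSucc N).X :=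
  hodgeConjectureFor_of_isDivisorGenerated _
    (AbelianVariety.isDivisorGenerated_powSucc_of_ribetTypeSeventeenSixtyTwo A φ hd hφ hE2 h17 h62 N)

/-- **79-FOLDS of signature `{17, 62}`: `B• = D•` on all powers — UNCONDITIONAL** (either eigenvalue may carry the `17`).
[cite: Ribet1983, Thm. 0 and Thm. 3] [cite: MoonenZarhin1999LowDim, §2 (2.4)] -/
theorem AbelianVariety.isDivisorGenerated_powSucc_of_seventyninefold_seventeenSixtyTwo (A : AbelianVariety ℂ)
    (φ : A ⟶ A) {d : ℕ} (hd : 0 < d) (hφ : φ ≫ φ = -(d • 𝟙 A)) (hE2 : Module.finrank ℚ A.endAlgebra = 2)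
    (hX : A.dim = 79)
    (h17 : eigenMultiplicity A φ (Complex.I * (Real.sqrt d : ℂ)) = 17 ∨
      eigenMultiplicity A φ (-(Complex.I * (Real.sqrt d : ℂ))) = 17)
    (N : ℕ) : IsDivisorGenerated (A.powSucc N) := by
  have hsum := eigenMultiplicity_add_eigenMultiplicity_neg_eq_dim A φ hd hφ
  rw [hX] at hsum
  rcases h17 with h | h
  · exact AbelianVariety.isDivisorGenerated_powSucc_of_ribetTypeSeventeenSixtyTwo A φ hd hφ hE2 h (by omega) N
  · exact AbelianVariety.isDivisorGenerated_powSucc_of_ribetTypeSeventeenSixtyTwo' A φ hd hφ hE2 (by omega) h N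

/-- **The Hodge conjecture for all powers of a 79-FOLD of signature `{17, 62}` — UNCONDITIONAL.**
[cite: Ribet1983, Thm. 3] [cite: Deligne2000, §1] -/
theorem hodgeConjectureFor_powSucc_of_seventyninefold_seventeenSixtyTwo (A : AbelianVariety ℂ)
    (φ : A ⟶ A) {d : ℕ} (hd : 0 < d) (hφ : φ ≫ φ = -(d • 𝟙 A)) (hE2 : Module.finrank ℚ A.endAlgebra = 2)
    (hX : A.dim = 79)
    (h17 : eigenMultiplicity A φ (Complex.I * (Real.sqrt d : ℂ)) = 17 ∨
      eigenMultiplicity A φ (-(Complex.I * (Real.sqrt d : ℂ))) = 17)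
    (N : ℕ) : HodgeConjectureFor (A.powSucc N).dim (A.powSucc N).X :=
  hodgeConjectureFor_of_isDivisorGenerated _
    (AbelianVariety.isDivisorGenerated_powSucc_of_seventyninefold_seventeenSixtyTwo A φ hd hφ hE2 hX h17 N)

/-- **Ribet 1983 Thm. 3 at `(n′, n″) = (19, 60)` — UNCONDITIONAL** (core `UnitaryNineteenSixty.eq_top_of_smul`).
[cite: Ribet1983, Thm. 0 and Thm. 3] [cite: Gordon1997, Thm. 6.3 (3) and Corollary] -/
theorem AbelianVariety.isDivisorGenerated_powSucc_of_ribetTypeNineteenSixty (A : AbelianVariety ℂ) (φ : A ⟶ A)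
    {d : ℕ} (hd : 0 < d) (hφ : φ ≫ φ = -(d • 𝟙 A)) (hE2 : Module.finrank ℚ A.endAlgebra = 2)
    (h19 : eigenMultiplicity A φ (Complex.I * (Real.sqrt d : ℂ)) = 19)
    (h60 : eigenMultiplicity A φ (-(Complex.I * (Real.sqrt d : ℂ))) = 60) (N : ℕ) :
    IsDivisorGenerated (A.powSucc N) := by
  refine AbelianVariety.isDivisorGenerated_powSucc_of_ribetType_ofCoreSmul A φ hd hφ hE2 (by omega) (by omega) ?_ N
  intro W' _ _ _ 𝔊 ι P' Q' s hbr hirr hι hιι hP' hQ' hfinP' hfinQ' hadd hsmul hsymm hPQ hdefP hdefQ hadj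
  exact UnitaryNineteenSixty.eq_top_of_smul hbr hirr hι hιι hP' hQ' (by rw [hfinP', h19]) (by rw [hfinQ', h60]) hadd
    hsmul hsymm hPQ hdefP hdefQ hadj

/-- The mirror: `n_{i√d}(φ) = 60`, `n_{−i√d}(φ) = 19` (core `UnitaryNineteenSixty.eq_top_of_smul'`).
[cite: Ribet1983, Thm. 0 and Thm. 3] [cite: Gordon1997, Thm. 6.3 (3) and Corollary] -/
theorem AbelianVariety.isDivisorGenerated_powSucc_of_ribetTypeNineteenSixty' (A : AbelianVariety ℂ) (φ : A ⟶ A)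
    {d : ℕ} (hd : 0 < d) (hφ : φ ≫ φ = -(d • 𝟙 A)) (hE2 : Module.finrank ℚ A.endAlgebra = 2)
    (h60 : eigenMultiplicity A φ (Complex.I * (Real.sqrt d : ℂ)) = 60)
    (h19 : eigenMultiplicity A φ (-(Complex.I * (Real.sqrt d : ℂ))) = 19) (N : ℕ) :
    IsDivisorGenerated (A.powSucc N) := by
  refine AbelianVariety.isDivisorGenerated_powSucc_of_ribetType_ofCoreSmul A φ hd hφ hE2 (by omega) (by omega) ?_ N
  intro W' _ _ _ 𝔊 ι P' Q' s hbr hirr hι hιι hP' hQ' hfinP' hfinQ' hadd hsmul hsymm hPQ hdefP hdefQ hadj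
  exact UnitaryNineteenSixty.eq_top_of_smul' hbr hirr hι hιι hP' hQ' (by rw [hfinP', h60]) (by rw [hfinQ', h19])
    hadd hsmul hsymm hPQ hdefP hdefQ hadj

/-- **The Hodge conjecture for all powers `A^{N+1}` of an abelian variety of Ribet type `(19, 60)` — UNCONDITIONAL.**
[cite: Ribet1983, Thm. 3] [cite: Deligne2000, §1] -/
theorem hodgeConjectureFor_powSucc_of_ribetTypeNineteenSixty (A : AbelianVariety ℂ) (φ : A ⟶ A)
    {d : ℕ} (hd : 0 < d) (hφ : φ ≫ φ = -(d • 𝟙 A)) (hE2 : Module.finrank ℚ A.endAlgebra = 2)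
    (h19 : eigenMultiplicity A φ (Complex.I * (Real.sqrt d : ℂ)) = 19)
    (h60 : eigenMultiplicity A φ (-(Complex.I * (Real.sqrt d : ℂ))) = 60) (N : ℕ) :
    HodgeConjectureFor (A.powSucc N).dim (A.powSucc N).X :=
  hodgeConjectureFor_of_isDivisorGenerated _
    (AbelianVariety.isDivisorGenerated_powSucc_of_ribetTypeNineteenSixty A φ hd hφ hE2 h19 h60 N)

/-- **79-FOLDS of signature `{19, 60}`: `B• = D•` on all powers — UNCONDITIONAL** (either eigenvalue may carry the `19`).
[cite: Ribet1983, Thm. 0 and Thm. 3] [cite: MoonenZarhin1999LowDim, §2 (2.4)] -/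
theorem AbelianVariety.isDivisorGenerated_powSucc_of_seventyninefold_nineteenSixty (A : AbelianVariety ℂ)
    (φ : A ⟶ A) {d : ℕ} (hd : 0 < d) (hφ : φ ≫ φ = -(d • 𝟙 A)) (hE2 : Module.finrank ℚ A.endAlgebra = 2)
    (hX : A.dim = 79)
    (h19 : eigenMultiplicity A φ (Complex.I * (Real.sqrt d : ℂ)) = 19 ∨
      eigenMultiplicity A φ (-(Complex.I * (Real.sqrt d : ℂ))) = 19)
    (N : ℕ) : IsDivisorGenerated (A.powSucc N) := by
  have hsum := eigenMultiplicity_add_eigenMultiplicity_neg_eq_dim A φ hd hφ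
  rw [hX] at hsum
  rcases h19 with h | h
  · exact AbelianVariety.isDivisorGenerated_powSucc_of_ribetTypeNineteenSixty A φ hd hφ hE2 h (by omega) N
  · exact AbelianVariety.isDivisorGenerated_powSucc_of_ribetTypeNineteenSixty' A φ hd hφ hE2 (by omega) h N

/-- **The Hodge conjecture for all powers of a 79-FOLD of signature `{19, 60}` — UNCONDITIONAL.**
[cite: Ribet1983, Thm. 3] [cite: Deligne2000, §1] -/
theorem hodgeConjectureFor_powSucc_of_seventyninefold_nineteenSixty (A : AbelianVariety ℂ)
    (φ : A ⟶ A) {d : ℕ} (hd : 0 < d) (hφ : φ ≫ φ = -(d • 𝟙 A)) (hE2 : Module.finrank ℚ A.endAlgebra = 2)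
    (hX : A.dim = 79)
    (h19 : eigenMultiplicity A φ (Complex.I * (Real.sqrt d : ℂ)) = 19 ∨
      eigenMultiplicity A φ (-(Complex.I * (Real.sqrt d : ℂ))) = 19)
    (N : ℕ) : HodgeConjectureFor (A.powSucc N).dim (A.powSucc N).X :=
  hodgeConjectureFor_of_isDivisorGenerated _
    (AbelianVariety.isDivisorGenerated_powSucc_of_seventyninefold_nineteenSixty A φ hd hφ hE2 hX h19 N)

/-- **Ribet 1983 Thm. 3 at `(n′, n″) = (21, 58)` — UNCONDITIONAL** (core `UnitaryTwentyOneFiftyEight.eq_top_of_smul`).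
[cite: Ribet1983, Thm. 0 and Thm. 3] [cite: Gordon1997, Thm. 6.3 (3) and Corollary] -/
theorem AbelianVariety.isDivisorGenerated_powSucc_of_ribetTypeTwentyOneFiftyEight (A : AbelianVariety ℂ) (φ : A ⟶ A)
    {d : ℕ} (hd : 0 < d) (hφ : φ ≫ φ = -(d • 𝟙 A)) (hE2 : Module.finrank ℚ A.endAlgebra = 2)
    (h21 : eigenMultiplicity A φ (Complex.I * (Real.sqrt d : ℂ)) = 21)
    (h58 : eigenMultiplicity A φ (-(Complex.I * (Real.sqrt d : ℂ))) = 58) (N : ℕ) :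
    IsDivisorGenerated (A.powSucc N) := by
  refine AbelianVariety.isDivisorGenerated_powSucc_of_ribetType_ofCoreSmul A φ hd hφ hE2 (by omega) (by omega) ?_ N
  intro W' _ _ _ 𝔊 ι P' Q' s hbr hirr hι hιι hP' hQ' hfinP' hfinQ' hadd hsmul hsymm hPQ hdefP hdefQ hadj
  exact UnitaryTwentyOneFiftyEight.eq_top_of_smul hbr hirr hι hιι hP' hQ' (by rw [hfinP', h21]) (by rw [hfinQ', h58]) hadd
    hsmul hsymm hPQ hdefP hdefQ hadj

/-- The mirror: `n_{i√d}(φ) = 58`, `n_{−i√d}(φ) = 21` (core `UnitaryTwentyOneFiftyEight.eq_top_of_smul'`).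
[cite: Ribet1983, Thm. 0 and Thm. 3] [cite: Gordon1997, Thm. 6.3 (3) and Corollary] -/
theorem AbelianVariety.isDivisorGenerated_powSucc_of_ribetTypeTwentyOneFiftyEight' (A : AbelianVariety ℂ) (φ : A ⟶ A)
    {d : ℕ} (hd : 0 < d) (hφ : φ ≫ φ = -(d • 𝟙 A)) (hE2 : Module.finrank ℚ A.endAlgebra = 2)
    (h58 : eigenMultiplicity A φ (Complex.I * (Real.sqrt d : ℂ)) = 58)
    (h21 : eigenMultiplicity A φ (-(Complex.I * (Real.sqrt d : ℂ))) = 21) (N : ℕ) :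
    IsDivisorGenerated (A.powSucc N) := by
  refine AbelianVariety.isDivisorGenerated_powSucc_of_ribetType_ofCoreSmul A φ hd hφ hE2 (by omega) (by omega) ?_ N
  intro W' _ _ _ 𝔊 ι P' Q' s hbr hirr hι hιι hP' hQ' hfinP' hfinQ' hadd hsmul hsymm hPQ hdefP hdefQ hadj
  exact UnitaryTwentyOneFiftyEight.eq_top_of_smul' hbr hirr hι hιι hP' hQ' (by rw [hfinP', h58]) (by rw [hfinQ', h21])
    hadd hsmul hsymm hPQ hdefP hdefQ hadj

/-- **The Hodge conjecture for all powers `A^{N+1}` of an abelian variety of Ribet type `(21, 58)` — UNCONDITIONAL.**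
[cite: Ribet1983, Thm. 3] [cite: Deligne2000, §1] -/
theorem hodgeConjectureFor_powSucc_of_ribetTypeTwentyOneFiftyEight (A : AbelianVariety ℂ) (φ : A ⟶ A)
    {d : ℕ} (hd : 0 < d) (hφ : φ ≫ φ = -(d • 𝟙 A)) (hE2 : Module.finrank ℚ A.endAlgebra = 2)
    (h21 : eigenMultiplicity A φ (Complex.I * (Real.sqrt d : ℂ)) = 21)
    (h58 : eigenMultiplicity A φ (-(Complex.I * (Real.sqrt d : ℂ))) = 58) (N : ℕ) :
    HodgeConjectureFor (A.powSucc N).dim (A.powSucc N).X :=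
  hodgeConjectureFor_of_isDivisorGenerated _
    (AbelianVariety.isDivisorGenerated_powSucc_of_ribetTypeTwentyOneFiftyEight A φ hd hφ hE2 h21 h58 N)

/-- **79-FOLDS of signature `{21, 58}`: `B• = D•` on all powers — UNCONDITIONAL** (either eigenvalue may carry the `21`).
[cite: Ribet1983, Thm. 0 and Thm. 3] [cite: MoonenZarhin1999LowDim, §2 (2.4)] -/
theorem AbelianVariety.isDivisorGenerated_powSucc_of_seventyninefold_twentyOneFiftyEight (A : AbelianVariety ℂ)
    (φ : A ⟶ A) {d : ℕ} (hd : 0 < d) (hφ : φ ≫ φ = -(d • 𝟙 A)) (hE2 : Module.finrank ℚ A.endAlgebra = 2)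
    (hX : A.dim = 79)
    (h21 : eigenMultiplicity A φ (Complex.I * (Real.sqrt d : ℂ)) = 21 ∨
      eigenMultiplicity A φ (-(Complex.I * (Real.sqrt d : ℂ))) = 21)
    (N : ℕ) : IsDivisorGenerated (A.powSucc N) := by
  have hsum := eigenMultiplicity_add_eigenMultiplicity_neg_eq_dim A φ hd hφ
  rw [hX] at hsum
  rcases h21 with h | h
  · exact AbelianVariety.isDivisorGenerated_powSucc_of_ribetTypeTwentyOneFiftyEight A φ hd hφ hE2 h (by omega) N
  · exact AbelianVariety.isDivisorGenerated_powSucc_of_ribetTypeTwentyOneFiftyEight' A φ hd hφ hE2 (by omega) h N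

/-- **The Hodge conjecture for all powers of a 79-FOLD of signature `{21, 58}` — UNCONDITIONAL.**
[cite: Ribet1983, Thm. 3] [cite: Deligne2000, §1] -/
theorem hodgeConjectureFor_powSucc_of_seventyninefold_twentyOneFiftyEight (A : AbelianVariety ℂ)
    (φ : A ⟶ A) {d : ℕ} (hd : 0 < d) (hφ : φ ≫ φ = -(d • 𝟙 A)) (hE2 : Module.finrank ℚ A.endAlgebra = 2)
    (hX : A.dim = 79)
    (h21 : eigenMultiplicity A φ (Complex.I * (Real.sqrt d : ℂ)) = 21 ∨
      eigenMultiplicity A φ (-(Complex.I * (Real.sqrt d : ℂ))) = 21)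
    (N : ℕ) : HodgeConjectureFor (A.powSucc N).dim (A.powSucc N).X :=
  hodgeConjectureFor_of_isDivisorGenerated _
    (AbelianVariety.isDivisorGenerated_powSucc_of_seventyninefold_twentyOneFiftyEight A φ hd hφ hE2 hX h21 N)

/-- **Ribet 1983 Thm. 3 at `(n′, n″) = (22, 57)` — UNCONDITIONAL** (core `UnitaryTwentyTwoFiftySeven.eq_top_of_smul`).
[cite: Ribet1983, Thm. 0 and Thm. 3] [cite: Gordon1997, Thm. 6.3 (3) and Corollary] -/
theorem AbelianVariety.isDivisorGenerated_powSucc_of_ribetTypeTwentyTwoFiftySeven (A : AbelianVariety ℂ) (φ : A ⟶ A)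
    {d : ℕ} (hd : 0 < d) (hφ : φ ≫ φ = -(d • 𝟙 A)) (hE2 : Module.finrank ℚ A.endAlgebra = 2)
    (h22 : eigenMultiplicity A φ (Complex.I * (Real.sqrt d : ℂ)) = 22)
    (h57 : eigenMultiplicity A φ (-(Complex.I * (Real.sqrt d : ℂ))) = 57) (N : ℕ) :
    IsDivisorGenerated (A.powSucc N) := by
  refine AbelianVariety.isDivisorGenerated_powSucc_of_ribetType_ofCoreSmul A φ hd hφ hE2 (by omega) (by omega) ?_ N
  intro W' _ _ _ 𝔊 ι P' Q' s hbr hirr hι hιι hP' hQ' hfinP' hfinQ' hadd hsmul hsymm hPQ hdefP hdefQ hadj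
  exact UnitaryTwentyTwoFiftySeven.eq_top_of_smul hbr hirr hι hιι hP' hQ' (by rw [hfinP', h22]) (by rw [hfinQ', h57]) hadd
    hsmul hsymm hPQ hdefP hdefQ hadj

/-- The mirror: `n_{i√d}(φ) = 57`, `n_{−i√d}(φ) = 22` (core `UnitaryTwentyTwoFiftySeven.eq_top_of_smul'`).
[cite: Ribet1983, Thm. 0 and Thm. 3] [cite: Gordon1997, Thm. 6.3 (3) and Corollary] -/
theorem AbelianVariety.isDivisorGenerated_powSucc_of_ribetTypeTwentyTwoFiftySeven' (A : AbelianVariety ℂ) (φ : A ⟶ A)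
    {d : ℕ} (hd : 0 < d) (hφ : φ ≫ φ = -(d • 𝟙 A)) (hE2 : Module.finrank ℚ A.endAlgebra = 2)
    (h57 : eigenMultiplicity A φ (Complex.I * (Real.sqrt d : ℂ)) = 57)
    (h22 : eigenMultiplicity A φ (-(Complex.I * (Real.sqrt d : ℂ))) = 22) (N : ℕ) :
    IsDivisorGenerated (A.powSucc N) := by
  refine AbelianVariety.isDivisorGenerated_powSucc_of_ribetType_ofCoreSmul A φ hd hφ hE2 (by omega) (by omega) ?_ N
  intro W' _ _ _ 𝔊 ι P' Q' s hbr hirr hι hιι hP' hQ' hfinP' hfinQ' hadd hsmul hsymm hPQ hdefP hdefQ hadj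
  exact UnitaryTwentyTwoFiftySeven.eq_top_of_smul' hbr hirr hι hιι hP' hQ' (by rw [hfinP', h57]) (by rw [hfinQ', h22])
    hadd hsmul hsymm hPQ hdefP hdefQ hadj

/-- **The Hodge conjecture for all powers `A^{N+1}` of an abelian variety of Ribet type `(22, 57)` — UNCONDITIONAL.**
[cite: Ribet1983, Thm. 3] [cite: Deligne2000, §1] -/
theorem hodgeConjectureFor_powSucc_of_ribetTypeTwentyTwoFiftySeven (A : AbelianVariety ℂ) (φ : A ⟶ A)
    {d : ℕ} (hd : 0 < d) (hφ : φ ≫ φ = -(d • 𝟙 A)) (hE2 : Module.finrank ℚ A.endAlgebra = 2)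
    (h22 : eigenMultiplicity A φ (Complex.I * (Real.sqrt d : ℂ)) = 22)
    (h57 : eigenMultiplicity A φ (-(Complex.I * (Real.sqrt d : ℂ))) = 57) (N : ℕ) :
    HodgeConjectureFor (A.powSucc N).dim (A.powSucc N).X :=
  hodgeConjectureFor_of_isDivisorGenerated _
    (AbelianVariety.isDivisorGenerated_powSucc_of_ribetTypeTwentyTwoFiftySeven A φ hd hφ hE2 h22 h57 N)

/-- **79-FOLDS of signature `{22, 57}`: `B• = D•` on all powers — UNCONDITIONAL** (either eigenvalue may carry the `22`).
[cite: Ribet1983, Thm. 0 and Thm. 3] [cite: MoonenZarhin1999LowDim, §2 (2.4)] -/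
theorem AbelianVariety.isDivisorGenerated_powSucc_of_seventyninefold_twentyTwoFiftySeven (A : AbelianVariety ℂ)
    (φ : A ⟶ A) {d : ℕ} (hd : 0 < d) (hφ : φ ≫ φ = -(d • 𝟙 A)) (hE2 : Module.finrank ℚ A.endAlgebra = 2)
    (hX : A.dim = 79)
    (h22 : eigenMultiplicity A φ (Complex.I * (Real.sqrt d : ℂ)) = 22 ∨
      eigenMultiplicity A φ (-(Complex.I * (Real.sqrt d : ℂ))) = 22)
    (N : ℕ) : IsDivisorGenerated (A.powSucc N) := by
  have hsum := eigenMultiplicity_add_eigenMultiplicity_neg_eq_dim A φ hd hφ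
  rw [hX] at hsum
  rcases h22 with h | h
  · exact AbelianVariety.isDivisorGenerated_powSucc_of_ribetTypeTwentyTwoFiftySeven A φ hd hφ hE2 h (by omega) N
  · exact AbelianVariety.isDivisorGenerated_powSucc_of_ribetTypeTwentyTwoFiftySeven' A φ hd hφ hE2 (by omega) h N

/-- **The Hodge conjecture for all powers of a 79-FOLD of signature `{22, 57}` — UNCONDITIONAL.**
[cite: Ribet1983, Thm. 3] [cite: Deligne2000, §1] -/
theorem hodgeConjectureFor_powSucc_of_seventyninefold_twentyTwoFiftySeven (A : AbelianVariety ℂ)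
    (φ : A ⟶ A) {d : ℕ} (hd : 0 < d) (hφ : φ ≫ φ = -(d • 𝟙 A)) (hE2 : Module.finrank ℚ A.endAlgebra = 2)
    (hX : A.dim = 79)
    (h22 : eigenMultiplicity A φ (Complex.I * (Real.sqrt d : ℂ)) = 22 ∨
      eigenMultiplicity A φ (-(Complex.I * (Real.sqrt d : ℂ))) = 22)
    (N : ℕ) : HodgeConjectureFor (A.powSucc N).dim (A.powSucc N).X :=
  hodgeConjectureFor_of_isDivisorGenerated _
    (AbelianVariety.isDivisorGenerated_powSucc_of_seventyninefold_twentyTwoFiftySeven A φ hd hφ hE2 hX h22 N)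

/-- **Ribet 1983 Thm. 3 at `(n′, n″) = (23, 56)` — UNCONDITIONAL** (core `UnitaryTwentyThreeFiftySix.eq_top_of_smul`).
[cite: Ribet1983, Thm. 0 and Thm. 3] [cite: Gordon1997, Thm. 6.3 (3) and Corollary] -/
theorem AbelianVariety.isDivisorGenerated_powSucc_of_ribetTypeTwentyThreeFiftySix (A : AbelianVariety ℂ) (φ : A ⟶ A)
    {d : ℕ} (hd : 0 < d) (hφ : φ ≫ φ = -(d • 𝟙 A)) (hE2 : Module.finrank ℚ A.endAlgebra = 2)
    (h23 : eigenMultiplicity A φ (Complex.I * (Real.sqrt d : ℂ)) = 23)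
    (h56 : eigenMultiplicity A φ (-(Complex.I * (Real.sqrt d : ℂ))) = 56) (N : ℕ) :
    IsDivisorGenerated (A.powSucc N) := by
  refine AbelianVariety.isDivisorGenerated_powSucc_of_ribetType_ofCoreSmul A φ hd hφ hE2 (by omega) (by omega) ?_ N
  intro W' _ _ _ 𝔊 ι P' Q' s hbr hirr hι hιι hP' hQ' hfinP' hfinQ' hadd hsmul hsymm hPQ hdefP hdefQ hadj
  exact UnitaryTwentyThreeFiftySix.eq_top_of_smul hbr hirr hι hιι hP' hQ' (by rw [hfinP', h23]) (by rw [hfinQ', h56]) hadd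
    hsmul hsymm hPQ hdefP hdefQ hadj

/-- The mirror: `n_{i√d}(φ) = 56`, `n_{−i√d}(φ) = 23` (core `UnitaryTwentyThreeFiftySix.eq_top_of_smul'`).
[cite: Ribet1983, Thm. 0 and Thm. 3] [cite: Gordon1997, Thm. 6.3 (3) and Corollary] -/
theorem AbelianVariety.isDivisorGenerated_powSucc_of_ribetTypeTwentyThreeFiftySix' (A : AbelianVariety ℂ) (φ : A ⟶ A)
    {d : ℕ} (hd : 0 < d) (hφ : φ ≫ φ = -(d • 𝟙 A)) (hE2 : Module.finrank ℚ A.endAlgebra = 2)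
    (h56 : eigenMultiplicity A φ (Complex.I * (Real.sqrt d : ℂ)) = 56)
    (h23 : eigenMultiplicity A φ (-(Complex.I * (Real.sqrt d : ℂ))) = 23) (N : ℕ) :
    IsDivisorGenerated (A.powSucc N) := by
  refine AbelianVariety.isDivisorGenerated_powSucc_of_ribetType_ofCoreSmul A φ hd hφ hE2 (by omega) (by omega) ?_ N
  intro W' _ _ _ 𝔊 ι P' Q' s hbr hirr hι hιι hP' hQ' hfinP' hfinQ' hadd hsmul hsymm hPQ hdefP hdefQ hadj
  exact UnitaryTwentyThreeFiftySix.eq_top_of_smul' hbr hirr hι hιι hP' hQ' (by rw [hfinP', h56]) (by rw [hfinQ', h23])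
    hadd hsmul hsymm hPQ hdefP hdefQ hadj

/-- **The Hodge conjecture for all powers `A^{N+1}` of an abelian variety of Ribet type `(23, 56)` — UNCONDITIONAL.**
[cite: Ribet1983, Thm. 3] [cite: Deligne2000, §1] -/
theorem hodgeConjectureFor_powSucc_of_ribetTypeTwentyThreeFiftySix (A : AbelianVariety ℂ) (φ : A ⟶ A)
    {d : ℕ} (hd : 0 < d) (hφ : φ ≫ φ = -(d • 𝟙 A)) (hE2 : Module.finrank ℚ A.endAlgebra = 2)
    (h23 : eigenMultiplicity A φ (Complex.I * (Real.sqrt d : ℂ)) = 23)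
    (h56 : eigenMultiplicity A φ (-(Complex.I * (Real.sqrt d : ℂ))) = 56) (N : ℕ) :
    HodgeConjectureFor (A.powSucc N).dim (A.powSucc N).X :=
  hodgeConjectureFor_of_isDivisorGenerated _
    (AbelianVariety.isDivisorGenerated_powSucc_of_ribetTypeTwentyThreeFiftySix A φ hd hφ hE2 h23 h56 N)

/-- **79-FOLDS of signature `{23, 56}`: `B• = D•` on all powers — UNCONDITIONAL** (either eigenvalue may carry the `23`).
[cite: Ribet1983, Thm. 0 and Thm. 3] [cite: MoonenZarhin1999LowDim, §2 (2.4)] -/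
theorem AbelianVariety.isDivisorGenerated_powSucc_of_seventyninefold_twentyThreeFiftySix (A : AbelianVariety ℂ)
    (φ : A ⟶ A) {d : ℕ} (hd : 0 < d) (hφ : φ ≫ φ = -(d • 𝟙 A)) (hE2 : Module.finrank ℚ A.endAlgebra = 2)
    (hX : A.dim = 79)
    (h23 : eigenMultiplicity A φ (Complex.I * (Real.sqrt d : ℂ)) = 23 ∨
      eigenMultiplicity A φ (-(Complex.I * (Real.sqrt d : ℂ))) = 23)
    (N : ℕ) : IsDivisorGenerated (A.powSucc N) := by
  have hsum := eigenMultiplicity_add_eigenMultiplicity_neg_eq_dim A φ hd hφ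
  rw [hX] at hsum
  rcases h23 with h | h
  · exact AbelianVariety.isDivisorGenerated_powSucc_of_ribetTypeTwentyThreeFiftySix A φ hd hφ hE2 h (by omega) N
  · exact AbelianVariety.isDivisorGenerated_powSucc_of_ribetTypeTwentyThreeFiftySix' A φ hd hφ hE2 (by omega) h N

/-- **The Hodge conjecture for all powers of a 79-FOLD of signature `{23, 56}` — UNCONDITIONAL.**
[cite: Ribet1983, Thm. 3] [cite: Deligne2000, §1] -/
theorem hodgeConjectureFor_powSucc_of_seventyninefold_twentyThreeFiftySix (A : AbelianVariety ℂ)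
    (φ : A ⟶ A) {d : ℕ} (hd : 0 < d) (hφ : φ ≫ φ = -(d • 𝟙 A)) (hE2 : Module.finrank ℚ A.endAlgebra = 2)
    (hX : A.dim = 79)
    (h23 : eigenMultiplicity A φ (Complex.I * (Real.sqrt d : ℂ)) = 23 ∨
      eigenMultiplicity A φ (-(Complex.I * (Real.sqrt d : ℂ))) = 23)
    (N : ℕ) : HodgeConjectureFor (A.powSucc N).dim (A.powSucc N).X :=
  hodgeConjectureFor_of_isDivisorGenerated _
    (AbelianVariety.isDivisorGenerated_powSucc_of_seventyninefold_twentyThreeFiftySix A φ hd hφ hE2 hX h23 N)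

/-- **Ribet 1983 Thm. 3 at `(n′, n″) = (24, 55)` — UNCONDITIONAL** (core `UnitaryTwentyFourFiftyFive.eq_top_of_smul`).
[cite: Ribet1983, Thm. 0 and Thm. 3] [cite: Gordon1997, Thm. 6.3 (3) and Corollary] -/
theorem AbelianVariety.isDivisorGenerated_powSucc_of_ribetTypeTwentyFourFiftyFive (A : AbelianVariety ℂ) (φ : A ⟶ A)
    {d : ℕ} (hd : 0 < d) (hφ : φ ≫ φ = -(d • 𝟙 A)) (hE2 : Module.finrank ℚ A.endAlgebra = 2)
    (h24 : eigenMultiplicity A φ (Complex.I * (Real.sqrt d : ℂ)) = 24)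
    (h55 : eigenMultiplicity A φ (-(Complex.I * (Real.sqrt d : ℂ))) = 55) (N : ℕ) :
    IsDivisorGenerated (A.powSucc N) := by
  refine AbelianVariety.isDivisorGenerated_powSucc_of_ribetType_ofCoreSmul A φ hd hφ hE2 (by omega) (by omega) ?_ N
  intro W' _ _ _ 𝔊 ι P' Q' s hbr hirr hι hιι hP' hQ' hfinP' hfinQ' hadd hsmul hsymm hPQ hdefP hdefQ hadj
  exact UnitaryTwentyFourFiftyFive.eq_top_of_smul hbr hirr hι hιι hP' hQ' (by rw [hfinP', h24]) (by rw [hfinQ', h55]) hadd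
    hsmul hsymm hPQ hdefP hdefQ hadj

/-- The mirror: `n_{i√d}(φ) = 55`, `n_{−i√d}(φ) = 24` (core `UnitaryTwentyFourFiftyFive.eq_top_of_smul'`).
[cite: Ribet1983, Thm. 0 and Thm. 3] [cite: Gordon1997, Thm. 6.3 (3) and Corollary] -/
theorem AbelianVariety.isDivisorGenerated_powSucc_of_ribetTypeTwentyFourFiftyFive' (A : AbelianVariety ℂ) (φ : A ⟶ A)
    {d : ℕ} (hd : 0 < d) (hφ : φ ≫ φ = -(d • 𝟙 A)) (hE2 : Module.finrank ℚ A.endAlgebra = 2)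
    (h55 : eigenMultiplicity A φ (Complex.I * (Real.sqrt d : ℂ)) = 55)
    (h24 : eigenMultiplicity A φ (-(Complex.I * (Real.sqrt d : ℂ))) = 24) (N : ℕ) :
    IsDivisorGenerated (A.powSucc N) := by
  refine AbelianVariety.isDivisorGenerated_powSucc_of_ribetType_ofCoreSmul A φ hd hφ hE2 (by omega) (by omega) ?_ N
  intro W' _ _ _ 𝔊 ι P' Q' s hbr hirr hι hιι hP' hQ' hfinP' hfinQ' hadd hsmul hsymm hPQ hdefP hdefQ hadj
  exact UnitaryTwentyFourFiftyFive.eq_top_of_smul' hbr hirr hι hιι hP' hQ' (by rw [hfinP', h55]) (by rw [hfinQ', h24])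
    hadd hsmul hsymm hPQ hdefP hdefQ hadj

/-- **The Hodge conjecture for all powers `A^{N+1}` of an abelian variety of Ribet type `(24, 55)` — UNCONDITIONAL.**
[cite: Ribet1983, Thm. 3] [cite: Deligne2000, §1] -/
theorem hodgeConjectureFor_powSucc_of_ribetTypeTwentyFourFiftyFive (A : AbelianVariety ℂ) (φ : A ⟶ A)
    {d : ℕ} (hd : 0 < d) (hφ : φ ≫ φ = -(d • 𝟙 A)) (hE2 : Module.finrank ℚ A.endAlgebra = 2)
    (h24 : eigenMultiplicity A φ (Complex.I * (Real.sqrt d : ℂ)) = 24)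
    (h55 : eigenMultiplicity A φ (-(Complex.I * (Real.sqrt d : ℂ))) = 55) (N : ℕ) :
    HodgeConjectureFor (A.powSucc N).dim (A.powSucc N).X :=
  hodgeConjectureFor_of_isDivisorGenerated _
    (AbelianVariety.isDivisorGenerated_powSucc_of_ribetTypeTwentyFourFiftyFive A φ hd hφ hE2 h24 h55 N)

/-- **79-FOLDS of signature `{24, 55}`: `B• = D•` on all powers — UNCONDITIONAL** (either eigenvalue may carry the `24`).
[cite: Ribet1983, Thm. 0 and Thm. 3] [cite: MoonenZarhin1999LowDim, §2 (2.4)] -/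
theorem AbelianVariety.isDivisorGenerated_powSucc_of_seventyninefold_twentyFourFiftyFive (A : AbelianVariety ℂ)
    (φ : A ⟶ A) {d : ℕ} (hd : 0 < d) (hφ : φ ≫ φ = -(d • 𝟙 A)) (hE2 : Module.finrank ℚ A.endAlgebra = 2)
    (hX : A.dim = 79)
    (h24 : eigenMultiplicity A φ (Complex.I * (Real.sqrt d : ℂ)) = 24 ∨
      eigenMultiplicity A φ (-(Complex.I * (Real.sqrt d : ℂ))) = 24)
    (N : ℕ) : IsDivisorGenerated (A.powSucc N) := by
  have hsum := eigenMultiplicity_add_eigenMultiplicity_neg_eq_dim A φ hd hφ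
  rw [hX] at hsum
  rcases h24 with h | h
  · exact AbelianVariety.isDivisorGenerated_powSucc_of_ribetTypeTwentyFourFiftyFive A φ hd hφ hE2 h (by omega) N
  · exact AbelianVariety.isDivisorGenerated_powSucc_of_ribetTypeTwentyFourFiftyFive' A φ hd hφ hE2 (by omega) h N

/-- **The Hodge conjecture for all powers of a 79-FOLD of signature `{24, 55}` — UNCONDITIONAL.**
[cite: Ribet1983, Thm. 3] [cite: Deligne2000, §1] -/
theorem hodgeConjectureFor_powSucc_of_seventyninefold_twentyFourFiftyFive (A : AbelianVariety ℂ)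
    (φ : A ⟶ A) {d : ℕ} (hd : 0 < d) (hφ : φ ≫ φ = -(d • 𝟙 A)) (hE2 : Module.finrank ℚ A.endAlgebra = 2)
    (hX : A.dim = 79)
    (h24 : eigenMultiplicity A φ (Complex.I * (Real.sqrt d : ℂ)) = 24 ∨
      eigenMultiplicity A φ (-(Complex.I * (Real.sqrt d : ℂ))) = 24)
    (N : ℕ) : HodgeConjectureFor (A.powSucc N).dim (A.powSucc N).X :=
  hodgeConjectureFor_of_isDivisorGenerated _
    (AbelianVariety.isDivisorGenerated_powSucc_of_seventyninefold_twentyFourFiftyFive A φ hd hφ hE2 hX h24 N)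

/-- **Ribet 1983 Thm. 3 at `(n′, n″) = (25, 54)` — UNCONDITIONAL** (core `UnitaryTwentyFiveFiftyFour.eq_top_of_smul`).
[cite: Ribet1983, Thm. 0 and Thm. 3] [cite: Gordon1997, Thm. 6.3 (3) and Corollary] -/
theorem AbelianVariety.isDivisorGenerated_powSucc_of_ribetTypeTwentyFiveFiftyFour (A : AbelianVariety ℂ) (φ : A ⟶ A)
    {d : ℕ} (hd : 0 < d) (hφ : φ ≫ φ = -(d • 𝟙 A)) (hE2 : Module.finrank ℚ A.endAlgebra = 2)
    (h25 : eigenMultiplicity A φ (Complex.I * (Real.sqrt d : ℂ)) = 25)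
    (h54 : eigenMultiplicity A φ (-(Complex.I * (Real.sqrt d : ℂ))) = 54) (N : ℕ) :
    IsDivisorGenerated (A.powSucc N) := by
  refine AbelianVariety.isDivisorGenerated_powSucc_of_ribetType_ofCoreSmul A φ hd hφ hE2 (by omega) (by omega) ?_ N
  intro W' _ _ _ 𝔊 ι P' Q' s hbr hirr hι hιι hP' hQ' hfinP' hfinQ' hadd hsmul hsymm hPQ hdefP hdefQ hadj
  exact UnitaryTwentyFiveFiftyFour.eq_top_of_smul hbr hirr hι hιι hP' hQ' (by rw [hfinP', h25]) (by rw [hfinQ', h54]) hadd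
    hsmul hsymm hPQ hdefP hdefQ hadj

/-- The mirror: `n_{i√d}(φ) = 54`, `n_{−i√d}(φ) = 25` (core `UnitaryTwentyFiveFiftyFour.eq_top_of_smul'`).
[cite: Ribet1983, Thm. 0 and Thm. 3] [cite: Gordon1997, Thm. 6.3 (3) and Corollary] -/
theorem AbelianVariety.isDivisorGenerated_powSucc_of_ribetTypeTwentyFiveFiftyFour' (A : AbelianVariety ℂ) (φ : A ⟶ A)
    {d : ℕ} (hd : 0 < d) (hφ : φ ≫ φ = -(d • 𝟙 A)) (hE2 : Module.finrank ℚ A.endAlgebra = 2)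
    (h54 : eigenMultiplicity A φ (Complex.I * (Real.sqrt d : ℂ)) = 54)
    (h25 : eigenMultiplicity A φ (-(Complex.I * (Real.sqrt d : ℂ))) = 25) (N : ℕ) :
    IsDivisorGenerated (A.powSucc N) := by
  refine AbelianVariety.isDivisorGenerated_powSucc_of_ribetType_ofCoreSmul A φ hd hφ hE2 (by omega) (by omega) ?_ N
  intro W' _ _ _ 𝔊 ι P' Q' s hbr hirr hι hιι hP' hQ' hfinP' hfinQ' hadd hsmul hsymm hPQ hdefP hdefQ hadj
  exact UnitaryTwentyFiveFiftyFour.eq_top_of_smul' hbr hirr hι hιι hP' hQ' (by rw [hfinP', h54]) (by rw [hfinQ', h25])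
    hadd hsmul hsymm hPQ hdefP hdefQ hadj

/-- **The Hodge conjecture for all powers `A^{N+1}` of an abelian variety of Ribet type `(25, 54)` — UNCONDITIONAL.**
[cite: Ribet1983, Thm. 3] [cite: Deligne2000, §1] -/
theorem hodgeConjectureFor_powSucc_of_ribetTypeTwentyFiveFiftyFour (A : AbelianVariety ℂ) (φ : A ⟶ A)
    {d : ℕ} (hd : 0 < d) (hφ : φ ≫ φ = -(d • 𝟙 A)) (hE2 : Module.finrank ℚ A.endAlgebra = 2)
    (h25 : eigenMultiplicity A φ (Complex.I * (Real.sqrt d : ℂ)) = 25)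
    (h54 : eigenMultiplicity A φ (-(Complex.I * (Real.sqrt d : ℂ))) = 54) (N : ℕ) :
    HodgeConjectureFor (A.powSucc N).dim (A.powSucc N).X :=
  hodgeConjectureFor_of_isDivisorGenerated _
    (AbelianVariety.isDivisorGenerated_powSucc_of_ribetTypeTwentyFiveFiftyFour A φ hd hφ hE2 h25 h54 N)

/-- **79-FOLDS of signature `{25, 54}`: `B• = D•` on all powers — UNCONDITIONAL** (either eigenvalue may carry the `25`).
[cite: Ribet1983, Thm. 0 and Thm. 3] [cite: MoonenZarhin1999LowDim, §2 (2.4)] -/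
theorem AbelianVariety.isDivisorGenerated_powSucc_of_seventyninefold_twentyFiveFiftyFour (A : AbelianVariety ℂ)
    (φ : A ⟶ A) {d : ℕ} (hd : 0 < d) (hφ : φ ≫ φ = -(d • 𝟙 A)) (hE2 : Module.finrank ℚ A.endAlgebra = 2)
    (hX : A.dim = 79)
    (h25 : eigenMultiplicity A φ (Complex.I * (Real.sqrt d : ℂ)) = 25 ∨
      eigenMultiplicity A φ (-(Complex.I * (Real.sqrt d : ℂ))) = 25)
    (N : ℕ) : IsDivisorGenerated (A.powSucc N) := by
  have hsum := eigenMultiplicity_add_eigenMultiplicity_neg_eq_dim A φ hd hφ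
  rw [hX] at hsum
  rcases h25 with h | h
  · exact AbelianVariety.isDivisorGenerated_powSucc_of_ribetTypeTwentyFiveFiftyFour A φ hd hφ hE2 h (by omega) N
  · exact AbelianVariety.isDivisorGenerated_powSucc_of_ribetTypeTwentyFiveFiftyFour' A φ hd hφ hE2 (by omega) h N

/-- **The Hodge conjecture for all powers of a 79-FOLD of signature `{25, 54}` — UNCONDITIONAL.**
[cite: Ribet1983, Thm. 3] [cite: Deligne2000, §1] -/
theorem hodgeConjectureFor_powSucc_of_seventyninefold_twentyFiveFiftyFour (A : AbelianVariety ℂ)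
    (φ : A ⟶ A) {d : ℕ} (hd : 0 < d) (hφ : φ ≫ φ = -(d • 𝟙 A)) (hE2 : Module.finrank ℚ A.endAlgebra = 2)
    (hX : A.dim = 79)
    (h25 : eigenMultiplicity A φ (Complex.I * (Real.sqrt d : ℂ)) = 25 ∨
      eigenMultiplicity A φ (-(Complex.I * (Real.sqrt d : ℂ))) = 25)
    (N : ℕ) : HodgeConjectureFor (A.powSucc N).dim (A.powSucc N).X :=
  hodgeConjectureFor_of_isDivisorGenerated _
    (AbelianVariety.isDivisorGenerated_powSucc_of_seventyninefold_twentyFiveFiftyFour A φ hd hφ hE2 hX h25 N)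

/-- **Ribet 1983 Thm. 3 at `(n′, n″) = (27, 52)` — UNCONDITIONAL** (core `UnitaryTwentySevenFiftyTwo.eq_top_of_smul`).
[cite: Ribet1983, Thm. 0 and Thm. 3] [cite: Gordon1997, Thm. 6.3 (3) and Corollary] -/
theorem AbelianVariety.isDivisorGenerated_powSucc_of_ribetTypeTwentySevenFiftyTwo (A : AbelianVariety ℂ) (φ : A ⟶ A)
    {d : ℕ} (hd : 0 < d) (hφ : φ ≫ φ = -(d • 𝟙 A)) (hE2 : Module.finrank ℚ A.endAlgebra = 2)
    (h27 : eigenMultiplicity A φ (Complex.I * (Real.sqrt d : ℂ)) = 27)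
    (h52 : eigenMultiplicity A φ (-(Complex.I * (Real.sqrt d : ℂ))) = 52) (N : ℕ) :
    IsDivisorGenerated (A.powSucc N) := by
  refine AbelianVariety.isDivisorGenerated_powSucc_of_ribetType_ofCoreSmul A φ hd hφ hE2 (by omega) (by omega) ?_ N
  intro W' _ _ _ 𝔊 ι P' Q' s hbr hirr hι hιι hP' hQ' hfinP' hfinQ' hadd hsmul hsymm hPQ hdefP hdefQ hadj
  exact UnitaryTwentySevenFiftyTwo.eq_top_of_smul hbr hirr hι hιι hP' hQ' (by rw [hfinP', h27]) (by rw [hfinQ', h52]) hadd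
    hsmul hsymm hPQ hdefP hdefQ hadj

/-- The mirror: `n_{i√d}(φ) = 52`, `n_{−i√d}(φ) = 27` (core `UnitaryTwentySevenFiftyTwo.eq_top_of_smul'`).
[cite: Ribet1983, Thm. 0 and Thm. 3] [cite: Gordon1997, Thm. 6.3 (3) and Corollary] -/
theorem AbelianVariety.isDivisorGenerated_powSucc_of_ribetTypeTwentySevenFiftyTwo' (A : AbelianVariety ℂ) (φ : A ⟶ A)
    {d : ℕ} (hd : 0 < d) (hφ : φ ≫ φ = -(d • 𝟙 A)) (hE2 : Module.finrank ℚ A.endAlgebra = 2)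
    (h52 : eigenMultiplicity A φ (Complex.I * (Real.sqrt d : ℂ)) = 52)
    (h27 : eigenMultiplicity A φ (-(Complex.I * (Real.sqrt d : ℂ))) = 27) (N : ℕ) :
    IsDivisorGenerated (A.powSucc N) := by
  refine AbelianVariety.isDivisorGenerated_powSucc_of_ribetType_ofCoreSmul A φ hd hφ hE2 (by omega) (by omega) ?_ N
  intro W' _ _ _ 𝔊 ι P' Q' s hbr hirr hι hιι hP' hQ' hfinP' hfinQ' hadd hsmul hsymm hPQ hdefP hdefQ hadj
  exact UnitaryTwentySevenFiftyTwo.eq_top_of_smul' hbr hirr hι hιι hP' hQ' (by rw [hfinP', h52]) (by rw [hfinQ', h27])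
    hadd hsmul hsymm hPQ hdefP hdefQ hadj

/-- **The Hodge conjecture for all powers `A^{N+1}` of an abelian variety of Ribet type `(27, 52)` — UNCONDITIONAL.**
[cite: Ribet1983, Thm. 3] [cite: Deligne2000, §1] -/
theorem hodgeConjectureFor_powSucc_of_ribetTypeTwentySevenFiftyTwo (A : AbelianVariety ℂ) (φ : A ⟶ A)
    {d : ℕ} (hd : 0 < d) (hφ : φ ≫ φ = -(d • 𝟙 A)) (hE2 : Module.finrank ℚ A.endAlgebra = 2)
    (h27 : eigenMultiplicity A φ (Complex.I * (Real.sqrt d : ℂ)) = 27)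
    (h52 : eigenMultiplicity A φ (-(Complex.I * (Real.sqrt d : ℂ))) = 52) (N : ℕ) :
    HodgeConjectureFor (A.powSucc N).dim (A.powSucc N).X :=
  hodgeConjectureFor_of_isDivisorGenerated _
    (AbelianVariety.isDivisorGenerated_powSucc_of_ribetTypeTwentySevenFiftyTwo A φ hd hφ hE2 h27 h52 N)

/-- **79-FOLDS of signature `{27, 52}`: `B• = D•` on all powers — UNCONDITIONAL** (either eigenvalue may carry the `27`).
[cite: Ribet1983, Thm. 0 and Thm. 3] [cite: MoonenZarhin1999LowDim, §2 (2.4)] -/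
theorem AbelianVariety.isDivisorGenerated_powSucc_of_seventyninefold_twentySevenFiftyTwo (A : AbelianVariety ℂ)
    (φ : A ⟶ A) {d : ℕ} (hd : 0 < d) (hφ : φ ≫ φ = -(d • 𝟙 A)) (hE2 : Module.finrank ℚ A.endAlgebra = 2)
    (hX : A.dim = 79)
    (h27 : eigenMultiplicity A φ (Complex.I * (Real.sqrt d : ℂ)) = 27 ∨
      eigenMultiplicity A φ (-(Complex.I * (Real.sqrt d : ℂ))) = 27)
    (N : ℕ) : IsDivisorGenerated (A.powSucc N) := by
  have hsum := eigenMultiplicity_add_eigenMultiplicity_neg_eq_dim A φ hd hφ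
  rw [hX] at hsum
  rcases h27 with h | h
  · exact AbelianVariety.isDivisorGenerated_powSucc_of_ribetTypeTwentySevenFiftyTwo A φ hd hφ hE2 h (by omega) N
  · exact AbelianVariety.isDivisorGenerated_powSucc_of_ribetTypeTwentySevenFiftyTwo' A φ hd hφ hE2 (by omega) h N

/-- **The Hodge conjecture for all powers of a 79-FOLD of signature `{27, 52}` — UNCONDITIONAL.**
[cite: Ribet1983, Thm. 3] [cite: Deligne2000, §1] -/
theorem hodgeConjectureFor_powSucc_of_seventyninefold_twentySevenFiftyTwo (A : AbelianVariety ℂ)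
    (φ : A ⟶ A) {d : ℕ} (hd : 0 < d) (hφ : φ ≫ φ = -(d • 𝟙 A)) (hE2 : Module.finrank ℚ A.endAlgebra = 2)
    (hX : A.dim = 79)
    (h27 : eigenMultiplicity A φ (Complex.I * (Real.sqrt d : ℂ)) = 27 ∨
      eigenMultiplicity A φ (-(Complex.I * (Real.sqrt d : ℂ))) = 27)
    (N : ℕ) : HodgeConjectureFor (A.powSucc N).dim (A.powSucc N).X :=
  hodgeConjectureFor_of_isDivisorGenerated _
    (AbelianVariety.isDivisorGenerated_powSucc_of_seventyninefold_twentySevenFiftyTwo A φ hd hφ hE2 hX h27 N)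

/-- **Ribet 1983 Thm. 3 at `(n′, n″) = (28, 51)` — UNCONDITIONAL** (core `UnitaryTwentyEightFiftyOne.eq_top_of_smul`).
[cite: Ribet1983, Thm. 0 and Thm. 3] [cite: Gordon1997, Thm. 6.3 (3) and Corollary] -/
theorem AbelianVariety.isDivisorGenerated_powSucc_of_ribetTypeTwentyEightFiftyOne (A : AbelianVariety ℂ) (φ : A ⟶ A)
    {d : ℕ} (hd : 0 < d) (hφ : φ ≫ φ = -(d • 𝟙 A)) (hE2 : Module.finrank ℚ A.endAlgebra = 2)
    (h28 : eigenMultiplicity A φ (Complex.I * (Real.sqrt d : ℂ)) = 28)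
    (h51 : eigenMultiplicity A φ (-(Complex.I * (Real.sqrt d : ℂ))) = 51) (N : ℕ) :
    IsDivisorGenerated (A.powSucc N) := by
  refine AbelianVariety.isDivisorGenerated_powSucc_of_ribetType_ofCoreSmul A φ hd hφ hE2 (by omega) (by omega) ?_ N
  intro W' _ _ _ 𝔊 ι P' Q' s hbr hirr hι hιι hP' hQ' hfinP' hfinQ' hadd hsmul hsymm hPQ hdefP hdefQ hadj
  exact UnitaryTwentyEightFiftyOne.eq_top_of_smul hbr hirr hι hιι hP' hQ' (by rw [hfinP', h28]) (by rw [hfinQ', h51]) hadd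
    hsmul hsymm hPQ hdefP hdefQ hadj

/-- The mirror: `n_{i√d}(φ) = 51`, `n_{−i√d}(φ) = 28` (core `UnitaryTwentyEightFiftyOne.eq_top_of_smul'`).
[cite: Ribet1983, Thm. 0 and Thm. 3] [cite: Gordon1997, Thm. 6.3 (3) and Corollary] -/
theorem AbelianVariety.isDivisorGenerated_powSucc_of_ribetTypeTwentyEightFiftyOne' (A : AbelianVariety ℂ) (φ : A ⟶ A)
    {d : ℕ} (hd : 0 < d) (hφ : φ ≫ φ = -(d • 𝟙 A)) (hE2 : Module.finrank ℚ A.endAlgebra = 2)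
    (h51 : eigenMultiplicity A φ (Complex.I * (Real.sqrt d : ℂ)) = 51)
    (h28 : eigenMultiplicity A φ (-(Complex.I * (Real.sqrt d : ℂ))) = 28) (N : ℕ) :
    IsDivisorGenerated (A.powSucc N) := by
  refine AbelianVariety.isDivisorGenerated_powSucc_of_ribetType_ofCoreSmul A φ hd hφ hE2 (by omega) (by omega) ?_ N
  intro W' _ _ _ 𝔊 ι P' Q' s hbr hirr hι hιι hP' hQ' hfinP' hfinQ' hadd hsmul hsymm hPQ hdefP hdefQ hadj
  exact UnitaryTwentyEightFiftyOne.eq_top_of_smul' hbr hirr hι hιι hP' hQ' (by rw [hfinP', h51]) (by rw [hfinQ', h28])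
    hadd hsmul hsymm hPQ hdefP hdefQ hadj

/-- **The Hodge conjecture for all powers `A^{N+1}` of an abelian variety of Ribet type `(28, 51)` — UNCONDITIONAL.**
[cite: Ribet1983, Thm. 3] [cite: Deligne2000, §1] -/
theorem hodgeConjectureFor_powSucc_of_ribetTypeTwentyEightFiftyOne (A : AbelianVariety ℂ) (φ : A ⟶ A)
    {d : ℕ} (hd : 0 < d) (hφ : φ ≫ φ = -(d • 𝟙 A)) (hE2 : Module.finrank ℚ A.endAlgebra = 2)
    (h28 : eigenMultiplicity A φ (Complex.I * (Real.sqrt d : ℂ)) = 28)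
    (h51 : eigenMultiplicity A φ (-(Complex.I * (Real.sqrt d : ℂ))) = 51) (N : ℕ) :
    HodgeConjectureFor (A.powSucc N).dim (A.powSucc N).X :=
  hodgeConjectureFor_of_isDivisorGenerated _
    (AbelianVariety.isDivisorGenerated_powSucc_of_ribetTypeTwentyEightFiftyOne A φ hd hφ hE2 h28 h51 N)

/-- **79-FOLDS of signature `{28, 51}`: `B• = D•` on all powers — UNCONDITIONAL** (either eigenvalue may carry the `28`).
[cite: Ribet1983, Thm. 0 and Thm. 3] [cite: MoonenZarhin1999LowDim, §2 (2.4)] -/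
theorem AbelianVariety.isDivisorGenerated_powSucc_of_seventyninefold_twentyEightFiftyOne (A : AbelianVariety ℂ)
    (φ : A ⟶ A) {d : ℕ} (hd : 0 < d) (hφ : φ ≫ φ = -(d • 𝟙 A)) (hE2 : Module.finrank ℚ A.endAlgebra = 2)
    (hX : A.dim = 79)
    (h28 : eigenMultiplicity A φ (Complex.I * (Real.sqrt d : ℂ)) = 28 ∨
      eigenMultiplicity A φ (-(Complex.I * (Real.sqrt d : ℂ))) = 28)
    (N : ℕ) : IsDivisorGenerated (A.powSucc N) := by
  have hsum := eigenMultiplicity_add_eigenMultiplicity_neg_eq_dim A φ hd hφ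
  rw [hX] at hsum
  rcases h28 with h | h
  · exact AbelianVariety.isDivisorGenerated_powSucc_of_ribetTypeTwentyEightFiftyOne A φ hd hφ hE2 h (by omega) N
  · exact AbelianVariety.isDivisorGenerated_powSucc_of_ribetTypeTwentyEightFiftyOne' A φ hd hφ hE2 (by omega) h N

/-- **The Hodge conjecture for all powers of a 79-FOLD of signature `{28, 51}` — UNCONDITIONAL.**
[cite: Ribet1983, Thm. 3] [cite: Deligne2000, §1] -/
theorem hodgeConjectureFor_powSucc_of_seventyninefold_twentyEightFiftyOne (A : AbelianVariety ℂ)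
    (φ : A ⟶ A) {d : ℕ} (hd : 0 < d) (hφ : φ ≫ φ = -(d • 𝟙 A)) (hE2 : Module.finrank ℚ A.endAlgebra = 2)
    (hX : A.dim = 79)
    (h28 : eigenMultiplicity A φ (Complex.I * (Real.sqrt d : ℂ)) = 28 ∨
      eigenMultiplicity A φ (-(Complex.I * (Real.sqrt d : ℂ))) = 28)
    (N : ℕ) : HodgeConjectureFor (A.powSucc N).dim (A.powSucc N).X :=
  hodgeConjectureFor_of_isDivisorGenerated _
    (AbelianVariety.isDivisorGenerated_powSucc_of_seventyninefold_twentyEightFiftyOne A φ hd hφ hE2 hX h28 N)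

/-- **Ribet 1983 Thm. 3 at `(n′, n″) = (29, 50)` — UNCONDITIONAL** (core `UnitaryTwentyNineFifty.eq_top_of_smul`).
[cite: Ribet1983, Thm. 0 and Thm. 3] [cite: Gordon1997, Thm. 6.3 (3) and Corollary] -/
theorem AbelianVariety.isDivisorGenerated_powSucc_of_ribetTypeTwentyNineFifty (A : AbelianVariety ℂ) (φ : A ⟶ A)
    {d : ℕ} (hd : 0 < d) (hφ : φ ≫ φ = -(d • 𝟙 A)) (hE2 : Module.finrank ℚ A.endAlgebra = 2)
    (h29 : eigenMultiplicity A φ (Complex.I * (Real.sqrt d : ℂ)) = 29)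
    (h50 : eigenMultiplicity A φ (-(Complex.I * (Real.sqrt d : ℂ))) = 50) (N : ℕ) :
    IsDivisorGenerated (A.powSucc N) := by
  refine AbelianVariety.isDivisorGenerated_powSucc_of_ribetType_ofCoreSmul A φ hd hφ hE2 (by omega) (by omega) ?_ N
  intro W' _ _ _ 𝔊 ι P' Q' s hbr hirr hι hιι hP' hQ' hfinP' hfinQ' hadd hsmul hsymm hPQ hdefP hdefQ hadj
  exact UnitaryTwentyNineFifty.eq_top_of_smul hbr hirr hι hιι hP' hQ' (by rw [hfinP', h29]) (by rw [hfinQ', h50]) hadd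
    hsmul hsymm hPQ hdefP hdefQ hadj

/-- The mirror: `n_{i√d}(φ) = 50`, `n_{−i√d}(φ) = 29` (core `UnitaryTwentyNineFifty.eq_top_of_smul'`).
[cite: Ribet1983, Thm. 0 and Thm. 3] [cite: Gordon1997, Thm. 6.3 (3) and Corollary] -/
theorem AbelianVariety.isDivisorGenerated_powSucc_of_ribetTypeTwentyNineFifty' (A : AbelianVariety ℂ) (φ : A ⟶ A)
    {d : ℕ} (hd : 0 < d) (hφ : φ ≫ φ = -(d • 𝟙 A)) (hE2 : Module.finrank ℚ A.endAlgebra = 2)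
    (h50 : eigenMultiplicity A φ (Complex.I * (Real.sqrt d : ℂ)) = 50)
    (h29 : eigenMultiplicity A φ (-(Complex.I * (Real.sqrt d : ℂ))) = 29) (N : ℕ) :
    IsDivisorGenerated (A.powSucc N) := by
  refine AbelianVariety.isDivisorGenerated_powSucc_of_ribetType_ofCoreSmul A φ hd hφ hE2 (by omega) (by omega) ?_ N
  intro W' _ _ _ 𝔊 ι P' Q' s hbr hirr hι hιι hP' hQ' hfinP' hfinQ' hadd hsmul hsymm hPQ hdefP hdefQ hadj
  exact UnitaryTwentyNineFifty.eq_top_of_smul' hbr hirr hι hιι hP' hQ' (by rw [hfinP', h50]) (by rw [hfinQ', h29])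
    hadd hsmul hsymm hPQ hdefP hdefQ hadj

/-- **The Hodge conjecture for all powers `A^{N+1}` of an abelian variety of Ribet type `(29, 50)` — UNCONDITIONAL.**
[cite: Ribet1983, Thm. 3] [cite: Deligne2000, §1] -/
theorem hodgeConjectureFor_powSucc_of_ribetTypeTwentyNineFifty (A : AbelianVariety ℂ) (φ : A ⟶ A)
    {d : ℕ} (hd : 0 < d) (hφ : φ ≫ φ = -(d • 𝟙 A)) (hE2 : Module.finrank ℚ A.endAlgebra = 2)
    (h29 : eigenMultiplicity A φ (Complex.I * (Real.sqrt d : ℂ)) = 29)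
    (h50 : eigenMultiplicity A φ (-(Complex.I * (Real.sqrt d : ℂ))) = 50) (N : ℕ) :
    HodgeConjectureFor (A.powSucc N).dim (A.powSucc N).X :=
  hodgeConjectureFor_of_isDivisorGenerated _
    (AbelianVariety.isDivisorGenerated_powSucc_of_ribetTypeTwentyNineFifty A φ hd hφ hE2 h29 h50 N)

/-- **79-FOLDS of signature `{29, 50}`: `B• = D•` on all powers — UNCONDITIONAL** (either eigenvalue may carry the `29`).
[cite: Ribet1983, Thm. 0 and Thm. 3] [cite: MoonenZarhin1999LowDim, §2 (2.4)] -/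
theorem AbelianVariety.isDivisorGenerated_powSucc_of_seventyninefold_twentyNineFifty (A : AbelianVariety ℂ)
    (φ : A ⟶ A) {d : ℕ} (hd : 0 < d) (hφ : φ ≫ φ = -(d • 𝟙 A)) (hE2 : Module.finrank ℚ A.endAlgebra = 2)
    (hX : A.dim = 79)
    (h29 : eigenMultiplicity A φ (Complex.I * (Real.sqrt d : ℂ)) = 29 ∨
      eigenMultiplicity A φ (-(Complex.I * (Real.sqrt d : ℂ))) = 29)
    (N : ℕ) : IsDivisorGenerated (A.powSucc N) := by
  have hsum := eigenMultiplicity_add_eigenMultiplicity_neg_eq_dim A φ hd hφ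
  rw [hX] at hsum
  rcases h29 with h | h
  · exact AbelianVariety.isDivisorGenerated_powSucc_of_ribetTypeTwentyNineFifty A φ hd hφ hE2 h (by omega) N
  · exact AbelianVariety.isDivisorGenerated_powSucc_of_ribetTypeTwentyNineFifty' A φ hd hφ hE2 (by omega) h N

/-- **The Hodge conjecture for all powers of a 79-FOLD of signature `{29, 50}` — UNCONDITIONAL.**
[cite: Ribet1983, Thm. 3] [cite: Deligne2000, §1] -/
theorem hodgeConjectureFor_powSucc_of_seventyninefold_twentyNineFifty (A : AbelianVariety ℂ)
    (φ : A ⟶ A) {d : ℕ} (hd : 0 < d) (hφ : φ ≫ φ = -(d • 𝟙 A)) (hE2 : Module.finrank ℚ A.endAlgebra = 2)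
    (hX : A.dim = 79)
    (h29 : eigenMultiplicity A φ (Complex.I * (Real.sqrt d : ℂ)) = 29 ∨
      eigenMultiplicity A φ (-(Complex.I * (Real.sqrt d : ℂ))) = 29)
    (N : ℕ) : HodgeConjectureFor (A.powSucc N).dim (A.powSucc N).X :=
  hodgeConjectureFor_of_isDivisorGenerated _
    (AbelianVariety.isDivisorGenerated_powSucc_of_seventyninefold_twentyNineFifty A φ hd hφ hE2 hX h29 N)

/-- **Ribet 1983 Thm. 3 at `(n′, n″) = (30, 49)` — UNCONDITIONAL** (core `UnitaryThirtyFortyNine.eq_top_of_smul`).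
[cite: Ribet1983, Thm. 0 and Thm. 3] [cite: Gordon1997, Thm. 6.3 (3) and Corollary] -/
theorem AbelianVariety.isDivisorGenerated_powSucc_of_ribetTypeThirtyFortyNine (A : AbelianVariety ℂ) (φ : A ⟶ A)
    {d : ℕ} (hd : 0 < d) (hφ : φ ≫ φ = -(d • 𝟙 A)) (hE2 : Module.finrank ℚ A.endAlgebra = 2)
    (h30 : eigenMultiplicity A φ (Complex.I * (Real.sqrt d : ℂ)) = 30)
    (h49 : eigenMultiplicity A φ (-(Complex.I * (Real.sqrt d : ℂ))) = 49) (N : ℕ) :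
    IsDivisorGenerated (A.powSucc N) := by
  refine AbelianVariety.isDivisorGenerated_powSucc_of_ribetType_ofCoreSmul A φ hd hφ hE2 (by omega) (by omega) ?_ N
  intro W' _ _ _ 𝔊 ι P' Q' s hbr hirr hι hιι hP' hQ' hfinP' hfinQ' hadd hsmul hsymm hPQ hdefP hdefQ hadj
  exact UnitaryThirtyFortyNine.eq_top_of_smul hbr hirr hι hιι hP' hQ' (by rw [hfinP', h30]) (by rw [hfinQ', h49]) hadd
    hsmul hsymm hPQ hdefP hdefQ hadj

/-- The mirror: `n_{i√d}(φ) = 49`, `n_{−i√d}(φ) = 30` (core `UnitaryThirtyFortyNine.eq_top_of_smul'`).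
[cite: Ribet1983, Thm. 0 and Thm. 3] [cite: Gordon1997, Thm. 6.3 (3) and Corollary] -/
theorem AbelianVariety.isDivisorGenerated_powSucc_of_ribetTypeThirtyFortyNine' (A : AbelianVariety ℂ) (φ : A ⟶ A)
    {d : ℕ} (hd : 0 < d) (hφ : φ ≫ φ = -(d • 𝟙 A)) (hE2 : Module.finrank ℚ A.endAlgebra = 2)
    (h49 : eigenMultiplicity A φ (Complex.I * (Real.sqrt d : ℂ)) = 49)
    (h30 : eigenMultiplicity A φ (-(Complex.I * (Real.sqrt d : ℂ))) = 30) (N : ℕ) :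
    IsDivisorGenerated (A.powSucc N) := by
  refine AbelianVariety.isDivisorGenerated_powSucc_of_ribetType_ofCoreSmul A φ hd hφ hE2 (by omega) (by omega) ?_ N
  intro W' _ _ _ 𝔊 ι P' Q' s hbr hirr hι hιι hP' hQ' hfinP' hfinQ' hadd hsmul hsymm hPQ hdefP hdefQ hadj
  exact UnitaryThirtyFortyNine.eq_top_of_smul' hbr hirr hι hιι hP' hQ' (by rw [hfinP', h49]) (by rw [hfinQ', h30])
    hadd hsmul hsymm hPQ hdefP hdefQ hadj

/-- **The Hodge conjecture for all powers `A^{N+1}` of an abelian variety of Ribet type `(30, 49)` — UNCONDITIONAL.**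
[cite: Ribet1983, Thm. 3] [cite: Deligne2000, §1] -/
theorem hodgeConjectureFor_powSucc_of_ribetTypeThirtyFortyNine (A : AbelianVariety ℂ) (φ : A ⟶ A)
    {d : ℕ} (hd : 0 < d) (hφ : φ ≫ φ = -(d • 𝟙 A)) (hE2 : Module.finrank ℚ A.endAlgebra = 2)
    (h30 : eigenMultiplicity A φ (Complex.I * (Real.sqrt d : ℂ)) = 30)
    (h49 : eigenMultiplicity A φ (-(Complex.I * (Real.sqrt d : ℂ))) = 49) (N : ℕ) :
    HodgeConjectureFor (A.powSucc N).dim (A.powSucc N).X :=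
  hodgeConjectureFor_of_isDivisorGenerated _
    (AbelianVariety.isDivisorGenerated_powSucc_of_ribetTypeThirtyFortyNine A φ hd hφ hE2 h30 h49 N)

/-- **79-FOLDS of signature `{30, 49}`: `B• = D•` on all powers — UNCONDITIONAL** (either eigenvalue may carry the `30`).
[cite: Ribet1983, Thm. 0 and Thm. 3] [cite: MoonenZarhin1999LowDim, §2 (2.4)] -/
theorem AbelianVariety.isDivisorGenerated_powSucc_of_seventyninefold_thirtyFortyNine (A : AbelianVariety ℂ)
    (φ : A ⟶ A) {d : ℕ} (hd : 0 < d) (hφ : φ ≫ φ = -(d • 𝟙 A)) (hE2 : Module.finrank ℚ A.endAlgebra = 2)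
    (hX : A.dim = 79)
    (h30 : eigenMultiplicity A φ (Complex.I * (Real.sqrt d : ℂ)) = 30 ∨
      eigenMultiplicity A φ (-(Complex.I * (Real.sqrt d : ℂ))) = 30)
    (N : ℕ) : IsDivisorGenerated (A.powSucc N) := by
  have hsum := eigenMultiplicity_add_eigenMultiplicity_neg_eq_dim A φ hd hφ
  rw [hX] at hsum
  rcases h30 with h | h
  · exact AbelianVariety.isDivisorGenerated_powSucc_of_ribetTypeThirtyFortyNine A φ hd hφ hE2 h (by omega) N
  · exact AbelianVariety.isDivisorGenerated_powSucc_of_ribetTypeThirtyFortyNine' A φ hd hφ hE2 (by omega) h N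

/-- **The Hodge conjecture for all powers of a 79-FOLD of signature `{30, 49}` — UNCONDITIONAL.**
[cite: Ribet1983, Thm. 3] [cite: Deligne2000, §1] -/
theorem hodgeConjectureFor_powSucc_of_seventyninefold_thirtyFortyNine (A : AbelianVariety ℂ)
    (φ : A ⟶ A) {d : ℕ} (hd : 0 < d) (hφ : φ ≫ φ = -(d • 𝟙 A)) (hE2 : Module.finrank ℚ A.endAlgebra = 2)
    (hX : A.dim = 79)
    (h30 : eigenMultiplicity A φ (Complex.I * (Real.sqrt d : ℂ)) = 30 ∨
      eigenMultiplicity A φ (-(Complex.I * (Real.sqrt d : ℂ))) = 30)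
    (N : ℕ) : HodgeConjectureFor (A.powSucc N).dim (A.powSucc N).X :=
  hodgeConjectureFor_of_isDivisorGenerated _
    (AbelianVariety.isDivisorGenerated_powSucc_of_seventyninefold_thirtyFortyNine A φ hd hφ hE2 hX h30 N)

/-- **Ribet 1983 Thm. 3 at `(n′, n″) = (31, 48)` — UNCONDITIONAL** (core `UnitaryThirtyOneFortyEight.eq_top_of_smul`).
[cite: Ribet1983, Thm. 0 and Thm. 3] [cite: Gordon1997, Thm. 6.3 (3) and Corollary] -/
theorem AbelianVariety.isDivisorGenerated_powSucc_of_ribetTypeThirtyOneFortyEight (A : AbelianVariety ℂ) (φ : A ⟶ A)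
    {d : ℕ} (hd : 0 < d) (hφ : φ ≫ φ = -(d • 𝟙 A)) (hE2 : Module.finrank ℚ A.endAlgebra = 2)
    (h31 : eigenMultiplicity A φ (Complex.I * (Real.sqrt d : ℂ)) = 31)
    (h48 : eigenMultiplicity A φ (-(Complex.I * (Real.sqrt d : ℂ))) = 48) (N : ℕ) :
    IsDivisorGenerated (A.powSucc N) := by
  refine AbelianVariety.isDivisorGenerated_powSucc_of_ribetType_ofCoreSmul A φ hd hφ hE2 (by omega) (by omega) ?_ N
  intro W' _ _ _ 𝔊 ι P' Q' s hbr hirr hι hιι hP' hQ' hfinP' hfinQ' hadd hsmul hsymm hPQ hdefP hdefQ hadj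
  exact UnitaryThirtyOneFortyEight.eq_top_of_smul hbr hirr hι hιι hP' hQ' (by rw [hfinP', h31]) (by rw [hfinQ', h48]) hadd
    hsmul hsymm hPQ hdefP hdefQ hadj

/-- The mirror: `n_{i√d}(φ) = 48`, `n_{−i√d}(φ) = 31` (core `UnitaryThirtyOneFortyEight.eq_top_of_smul'`).
[cite: Ribet1983, Thm. 0 and Thm. 3] [cite: Gordon1997, Thm. 6.3 (3) and Corollary] -/
theorem AbelianVariety.isDivisorGenerated_powSucc_of_ribetTypeThirtyOneFortyEight' (A : AbelianVariety ℂ) (φ : A ⟶ A)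
    {d : ℕ} (hd : 0 < d) (hφ : φ ≫ φ = -(d • 𝟙 A)) (hE2 : Module.finrank ℚ A.endAlgebra = 2)
    (h48 : eigenMultiplicity A φ (Complex.I * (Real.sqrt d : ℂ)) = 48)
    (h31 : eigenMultiplicity A φ (-(Complex.I * (Real.sqrt d : ℂ))) = 31) (N : ℕ) :
    IsDivisorGenerated (A.powSucc N) := by
  refine AbelianVariety.isDivisorGenerated_powSucc_of_ribetType_ofCoreSmul A φ hd hφ hE2 (by omega) (by omega) ?_ N
  intro W' _ _ _ 𝔊 ι P' Q' s hbr hirr hι hιι hP' hQ' hfinP' hfinQ' hadd hsmul hsymm hPQ hdefP hdefQ hadj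
  exact UnitaryThirtyOneFortyEight.eq_top_of_smul' hbr hirr hι hιι hP' hQ' (by rw [hfinP', h48]) (by rw [hfinQ', h31])
    hadd hsmul hsymm hPQ hdefP hdefQ hadj

/-- **The Hodge conjecture for all powers `A^{N+1}` of an abelian variety of Ribet type `(31, 48)` — UNCONDITIONAL.**
[cite: Ribet1983, Thm. 3] [cite: Deligne2000, §1] -/
theorem hodgeConjectureFor_powSucc_of_ribetTypeThirtyOneFortyEight (A : AbelianVariety ℂ) (φ : A ⟶ A)
    {d : ℕ} (hd : 0 < d) (hφ : φ ≫ φ = -(d • 𝟙 A)) (hE2 : Module.finrank ℚ A.endAlgebra = 2)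
    (h31 : eigenMultiplicity A φ (Complex.I * (Real.sqrt d : ℂ)) = 31)
    (h48 : eigenMultiplicity A φ (-(Complex.I * (Real.sqrt d : ℂ))) = 48) (N : ℕ) :
    HodgeConjectureFor (A.powSucc N).dim (A.powSucc N).X :=
  hodgeConjectureFor_of_isDivisorGenerated _
    (AbelianVariety.isDivisorGenerated_powSucc_of_ribetTypeThirtyOneFortyEight A φ hd hφ hE2 h31 h48 N)

/-- **79-FOLDS of signature `{31, 48}`: `B• = D•` on all powers — UNCONDITIONAL** (either eigenvalue may carry the `31`).
[cite: Ribet1983, Thm. 0 and Thm. 3] [cite: MoonenZarhin1999LowDim, §2 (2.4)] -/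
theorem AbelianVariety.isDivisorGenerated_powSucc_of_seventyninefold_thirtyOneFortyEight (A : AbelianVariety ℂ)
    (φ : A ⟶ A) {d : ℕ} (hd : 0 < d) (hφ : φ ≫ φ = -(d • 𝟙 A)) (hE2 : Module.finrank ℚ A.endAlgebra = 2)
    (hX : A.dim = 79)
    (h31 : eigenMultiplicity A φ (Complex.I * (Real.sqrt d : ℂ)) = 31 ∨
      eigenMultiplicity A φ (-(Complex.I * (Real.sqrt d : ℂ))) = 31)
    (N : ℕ) : IsDivisorGenerated (A.powSucc N) := by
  have hsum := eigenMultiplicity_add_eigenMultiplicity_neg_eq_dim A φ hd hφ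
  rw [hX] at hsum
  rcases h31 with h | h
  · exact AbelianVariety.isDivisorGenerated_powSucc_of_ribetTypeThirtyOneFortyEight A φ hd hφ hE2 h (by omega) N
  · exact AbelianVariety.isDivisorGenerated_powSucc_of_ribetTypeThirtyOneFortyEight' A φ hd hφ hE2 (by omega) h N

/-- **The Hodge conjecture for all powers of a 79-FOLD of signature `{31, 48}` — UNCONDITIONAL.**
[cite: Ribet1983, Thm. 3] [cite: Deligne2000, §1] -/
theorem hodgeConjectureFor_powSucc_of_seventyninefold_thirtyOneFortyEight (A : AbelianVariety ℂ)
    (φ : A ⟶ A) {d : ℕ} (hd : 0 < d) (hφ : φ ≫ φ = -(d • 𝟙 A)) (hE2 : Module.finrank ℚ A.endAlgebra = 2)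
    (hX : A.dim = 79)
    (h31 : eigenMultiplicity A φ (Complex.I * (Real.sqrt d : ℂ)) = 31 ∨
      eigenMultiplicity A φ (-(Complex.I * (Real.sqrt d : ℂ))) = 31)
    (N : ℕ) : HodgeConjectureFor (A.powSucc N).dim (A.powSucc N).X :=
  hodgeConjectureFor_of_isDivisorGenerated _
    (AbelianVariety.isDivisorGenerated_powSucc_of_seventyninefold_thirtyOneFortyEight A φ hd hφ hE2 hX h31 N)

/-- **Ribet 1983 Thm. 3 at `(n′, n″) = (33, 46)` — UNCONDITIONAL** (core `UnitaryThirtyThreeFortySix.eq_top_of_smul`).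
[cite: Ribet1983, Thm. 0 and Thm. 3] [cite: Gordon1997, Thm. 6.3 (3) and Corollary] -/
theorem AbelianVariety.isDivisorGenerated_powSucc_of_ribetTypeThirtyThreeFortySix (A : AbelianVariety ℂ) (φ : A ⟶ A)
    {d : ℕ} (hd : 0 < d) (hφ : φ ≫ φ = -(d • 𝟙 A)) (hE2 : Module.finrank ℚ A.endAlgebra = 2)
    (h33 : eigenMultiplicity A φ (Complex.I * (Real.sqrt d : ℂ)) = 33)
    (h46 : eigenMultiplicity A φ (-(Complex.I * (Real.sqrt d : ℂ))) = 46) (N : ℕ) :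
    IsDivisorGenerated (A.powSucc N) := by
  refine AbelianVariety.isDivisorGenerated_powSucc_of_ribetType_ofCoreSmul A φ hd hφ hE2 (by omega) (by omega) ?_ N
  intro W' _ _ _ 𝔊 ι P' Q' s hbr hirr hι hιι hP' hQ' hfinP' hfinQ' hadd hsmul hsymm hPQ hdefP hdefQ hadj
  exact UnitaryThirtyThreeFortySix.eq_top_of_smul hbr hirr hι hιι hP' hQ' (by rw [hfinP', h33]) (by rw [hfinQ', h46]) hadd
    hsmul hsymm hPQ hdefP hdefQ hadj

/-- The mirror: `n_{i√d}(φ) = 46`, `n_{−i√d}(φ) = 33` (core `UnitaryThirtyThreeFortySix.eq_top_of_smul'`).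
[cite: Ribet1983, Thm. 0 and Thm. 3] [cite: Gordon1997, Thm. 6.3 (3) and Corollary] -/
theorem AbelianVariety.isDivisorGenerated_powSucc_of_ribetTypeThirtyThreeFortySix' (A : AbelianVariety ℂ) (φ : A ⟶ A)
    {d : ℕ} (hd : 0 < d) (hφ : φ ≫ φ = -(d • 𝟙 A)) (hE2 : Module.finrank ℚ A.endAlgebra = 2)
    (h46 : eigenMultiplicity A φ (Complex.I * (Real.sqrt d : ℂ)) = 46)
    (h33 : eigenMultiplicity A φ (-(Complex.I * (Real.sqrt d : ℂ))) = 33) (N : ℕ) :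
    IsDivisorGenerated (A.powSucc N) := by
  refine AbelianVariety.isDivisorGenerated_powSucc_of_ribetType_ofCoreSmul A φ hd hφ hE2 (by omega) (by omega) ?_ N
  intro W' _ _ _ 𝔊 ι P' Q' s hbr hirr hι hιι hP' hQ' hfinP' hfinQ' hadd hsmul hsymm hPQ hdefP hdefQ hadj
  exact UnitaryThirtyThreeFortySix.eq_top_of_smul' hbr hirr hι hιι hP' hQ' (by rw [hfinP', h46]) (by rw [hfinQ', h33])
    hadd hsmul hsymm hPQ hdefP hdefQ hadj

/-- **The Hodge conjecture for all powers `A^{N+1}` of an abelian variety of Ribet type `(33, 46)` — UNCONDITIONAL.**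
[cite: Ribet1983, Thm. 3] [cite: Deligne2000, §1] -/
theorem hodgeConjectureFor_powSucc_of_ribetTypeThirtyThreeFortySix (A : AbelianVariety ℂ) (φ : A ⟶ A)
    {d : ℕ} (hd : 0 < d) (hφ : φ ≫ φ = -(d • 𝟙 A)) (hE2 : Module.finrank ℚ A.endAlgebra = 2)
    (h33 : eigenMultiplicity A φ (Complex.I * (Real.sqrt d : ℂ)) = 33)
    (h46 : eigenMultiplicity A φ (-(Complex.I * (Real.sqrt d : ℂ))) = 46) (N : ℕ) :
    HodgeConjectureFor (A.powSucc N).dim (A.powSucc N).X :=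
  hodgeConjectureFor_of_isDivisorGenerated _
    (AbelianVariety.isDivisorGenerated_powSucc_of_ribetTypeThirtyThreeFortySix A φ hd hφ hE2 h33 h46 N)

/-- **79-FOLDS of signature `{33, 46}`: `B• = D•` on all powers — UNCONDITIONAL** (either eigenvalue may carry the `33`).
[cite: Ribet1983, Thm. 0 and Thm. 3] [cite: MoonenZarhin1999LowDim, §2 (2.4)] -/
theorem AbelianVariety.isDivisorGenerated_powSucc_of_seventyninefold_thirtyThreeFortySix (A : AbelianVariety ℂ)
    (φ : A ⟶ A) {d : ℕ} (hd : 0 < d) (hφ : φ ≫ φ = -(d • 𝟙 A)) (hE2 : Module.finrank ℚ A.endAlgebra = 2)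
    (hX : A.dim = 79)
    (h33 : eigenMultiplicity A φ (Complex.I * (Real.sqrt d : ℂ)) = 33 ∨
      eigenMultiplicity A φ (-(Complex.I * (Real.sqrt d : ℂ))) = 33)
    (N : ℕ) : IsDivisorGenerated (A.powSucc N) := by
  have hsum := eigenMultiplicity_add_eigenMultiplicity_neg_eq_dim A φ hd hφ
  rw [hX] at hsum
  rcases h33 with h | h
  · exact AbelianVariety.isDivisorGenerated_powSucc_of_ribetTypeThirtyThreeFortySix A φ hd hφ hE2 h (by omega) N
  · exact AbelianVariety.isDivisorGenerated_powSucc_of_ribetTypeThirtyThreeFortySix' A φ hd hφ hE2 (by omega) h N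

/-- **The Hodge conjecture for all powers of a 79-FOLD of signature `{33, 46}` — UNCONDITIONAL.**
[cite: Ribet1983, Thm. 3] [cite: Deligne2000, §1] -/
theorem hodgeConjectureFor_powSucc_of_seventyninefold_thirtyThreeFortySix (A : AbelianVariety ℂ)
    (φ : A ⟶ A) {d : ℕ} (hd : 0 < d) (hφ : φ ≫ φ = -(d • 𝟙 A)) (hE2 : Module.finrank ℚ A.endAlgebra = 2)
    (hX : A.dim = 79)
    (h33 : eigenMultiplicity A φ (Complex.I * (Real.sqrt d : ℂ)) = 33 ∨
      eigenMultiplicity A φ (-(Complex.I * (Real.sqrt d : ℂ))) = 33)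
    (N : ℕ) : HodgeConjectureFor (A.powSucc N).dim (A.powSucc N).X :=
  hodgeConjectureFor_of_isDivisorGenerated _
    (AbelianVariety.isDivisorGenerated_powSucc_of_seventyninefold_thirtyThreeFortySix A φ hd hφ hE2 hX h33 N)

/-- **Ribet 1983 Thm. 3 at `(n′, n″) = (34, 45)` — UNCONDITIONAL** (core `UnitaryThirtyFourFortyFive.eq_top_of_smul`).
[cite: Ribet1983, Thm. 0 and Thm. 3] [cite: Gordon1997, Thm. 6.3 (3) and Corollary] -/
theorem AbelianVariety.isDivisorGenerated_powSucc_of_ribetTypeThirtyFourFortyFive (A : AbelianVariety ℂ) (φ : A ⟶ A)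
    {d : ℕ} (hd : 0 < d) (hφ : φ ≫ φ = -(d • 𝟙 A)) (hE2 : Module.finrank ℚ A.endAlgebra = 2)
    (h34 : eigenMultiplicity A φ (Complex.I * (Real.sqrt d : ℂ)) = 34)
    (h45 : eigenMultiplicity A φ (-(Complex.I * (Real.sqrt d : ℂ))) = 45) (N : ℕ) :
    IsDivisorGenerated (A.powSucc N) := by
  refine AbelianVariety.isDivisorGenerated_powSucc_of_ribetType_ofCoreSmul A φ hd hφ hE2 (by omega) (by omega) ?_ N
  intro W' _ _ _ 𝔊 ι P' Q' s hbr hirr hι hιι hP' hQ' hfinP' hfinQ' hadd hsmul hsymm hPQ hdefP hdefQ hadj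
  exact UnitaryThirtyFourFortyFive.eq_top_of_smul hbr hirr hι hιι hP' hQ' (by rw [hfinP', h34]) (by rw [hfinQ', h45]) hadd
    hsmul hsymm hPQ hdefP hdefQ hadj

/-- The mirror: `n_{i√d}(φ) = 45`, `n_{−i√d}(φ) = 34` (core `UnitaryThirtyFourFortyFive.eq_top_of_smul'`).
[cite: Ribet1983, Thm. 0 and Thm. 3] [cite: Gordon1997, Thm. 6.3 (3) and Corollary] -/
theorem AbelianVariety.isDivisorGenerated_powSucc_of_ribetTypeThirtyFourFortyFive' (A : AbelianVariety ℂ) (φ : A ⟶ A)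
    {d : ℕ} (hd : 0 < d) (hφ : φ ≫ φ = -(d • 𝟙 A)) (hE2 : Module.finrank ℚ A.endAlgebra = 2)
    (h45 : eigenMultiplicity A φ (Complex.I * (Real.sqrt d : ℂ)) = 45)
    (h34 : eigenMultiplicity A φ (-(Complex.I * (Real.sqrt d : ℂ))) = 34) (N : ℕ) :
    IsDivisorGenerated (A.powSucc N) := by
  refine AbelianVariety.isDivisorGenerated_powSucc_of_ribetType_ofCoreSmul A φ hd hφ hE2 (by omega) (by omega) ?_ N
  intro W' _ _ _ 𝔊 ι P' Q' s hbr hirr hι hιι hP' hQ' hfinP' hfinQ' hadd hsmul hsymm hPQ hdefP hdefQ hadj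
  exact UnitaryThirtyFourFortyFive.eq_top_of_smul' hbr hirr hι hιι hP' hQ' (by rw [hfinP', h45]) (by rw [hfinQ', h34])
    hadd hsmul hsymm hPQ hdefP hdefQ hadj

/-- **The Hodge conjecture for all powers `A^{N+1}` of an abelian variety of Ribet type `(34, 45)` — UNCONDITIONAL.**
[cite: Ribet1983, Thm. 3] [cite: Deligne2000, §1] -/
theorem hodgeConjectureFor_powSucc_of_ribetTypeThirtyFourFortyFive (A : AbelianVariety ℂ) (φ : A ⟶ A)
    {d : ℕ} (hd : 0 < d) (hφ : φ ≫ φ = -(d • 𝟙 A)) (hE2 : Module.finrank ℚ A.endAlgebra = 2)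
    (h34 : eigenMultiplicity A φ (Complex.I * (Real.sqrt d : ℂ)) = 34)
    (h45 : eigenMultiplicity A φ (-(Complex.I * (Real.sqrt d : ℂ))) = 45) (N : ℕ) :
    HodgeConjectureFor (A.powSucc N).dim (A.powSucc N).X :=
  hodgeConjectureFor_of_isDivisorGenerated _
    (AbelianVariety.isDivisorGenerated_powSucc_of_ribetTypeThirtyFourFortyFive A φ hd hφ hE2 h34 h45 N)

/-- **79-FOLDS of signature `{34, 45}`: `B• = D•` on all powers — UNCONDITIONAL** (either eigenvalue may carry the `34`).
[cite: Ribet1983, Thm. 0 and Thm. 3] [cite: MoonenZarhin1999LowDim, §2 (2.4)] -/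
theorem AbelianVariety.isDivisorGenerated_powSucc_of_seventyninefold_thirtyFourFortyFive (A : AbelianVariety ℂ)
    (φ : A ⟶ A) {d : ℕ} (hd : 0 < d) (hφ : φ ≫ φ = -(d • 𝟙 A)) (hE2 : Module.finrank ℚ A.endAlgebra = 2)
    (hX : A.dim = 79)
    (h34 : eigenMultiplicity A φ (Complex.I * (Real.sqrt d : ℂ)) = 34 ∨
      eigenMultiplicity A φ (-(Complex.I * (Real.sqrt d : ℂ))) = 34)
    (N : ℕ) : IsDivisorGenerated (A.powSucc N) := by
  have hsum := eigenMultiplicity_add_eigenMultiplicity_neg_eq_dim A φ hd hφ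
  rw [hX] at hsum
  rcases h34 with h | h
  · exact AbelianVariety.isDivisorGenerated_powSucc_of_ribetTypeThirtyFourFortyFive A φ hd hφ hE2 h (by omega) N
  · exact AbelianVariety.isDivisorGenerated_powSucc_of_ribetTypeThirtyFourFortyFive' A φ hd hφ hE2 (by omega) h N

/-- **The Hodge conjecture for all powers of a 79-FOLD of signature `{34, 45}` — UNCONDITIONAL.**
[cite: Ribet1983, Thm. 3] [cite: Deligne2000, §1] -/
theorem hodgeConjectureFor_powSucc_of_seventyninefold_thirtyFourFortyFive (A : AbelianVariety ℂ)
    (φ : A ⟶ A) {d : ℕ} (hd : 0 < d) (hφ : φ ≫ φ = -(d • 𝟙 A)) (hE2 : Module.finrank ℚ A.endAlgebra = 2)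
    (hX : A.dim = 79)
    (h34 : eigenMultiplicity A φ (Complex.I * (Real.sqrt d : ℂ)) = 34 ∨
      eigenMultiplicity A φ (-(Complex.I * (Real.sqrt d : ℂ))) = 34)
    (N : ℕ) : HodgeConjectureFor (A.powSucc N).dim (A.powSucc N).X :=
  hodgeConjectureFor_of_isDivisorGenerated _
    (AbelianVariety.isDivisorGenerated_powSucc_of_seventyninefold_thirtyFourFortyFive A φ hd hφ hE2 hX h34 N)

/-- **Ribet 1983 Thm. 3 at `(n′, n″) = (35, 44)` — UNCONDITIONAL** (core `UnitaryThirtyFiveFortyFour.eq_top_of_smul`).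
[cite: Ribet1983, Thm. 0 and Thm. 3] [cite: Gordon1997, Thm. 6.3 (3) and Corollary] -/
theorem AbelianVariety.isDivisorGenerated_powSucc_of_ribetTypeThirtyFiveFortyFour (A : AbelianVariety ℂ) (φ : A ⟶ A)
    {d : ℕ} (hd : 0 < d) (hφ : φ ≫ φ = -(d • 𝟙 A)) (hE2 : Module.finrank ℚ A.endAlgebra = 2)
    (h35 : eigenMultiplicity A φ (Complex.I * (Real.sqrt d : ℂ)) = 35)
    (h44 : eigenMultiplicity A φ (-(Complex.I * (Real.sqrt d : ℂ))) = 44) (N : ℕ) :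
    IsDivisorGenerated (A.powSucc N) := by
  refine AbelianVariety.isDivisorGenerated_powSucc_of_ribetType_ofCoreSmul A φ hd hφ hE2 (by omega) (by omega) ?_ N
  intro W' _ _ _ 𝔊 ι P' Q' s hbr hirr hι hιι hP' hQ' hfinP' hfinQ' hadd hsmul hsymm hPQ hdefP hdefQ hadj
  exact UnitaryThirtyFiveFortyFour.eq_top_of_smul hbr hirr hι hιι hP' hQ' (by rw [hfinP', h35]) (by rw [hfinQ', h44]) hadd
    hsmul hsymm hPQ hdefP hdefQ hadj

/-- The mirror: `n_{i√d}(φ) = 44`, `n_{−i√d}(φ) = 35` (core `UnitaryThirtyFiveFortyFour.eq_top_of_smul'`).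
[cite: Ribet1983, Thm. 0 and Thm. 3] [cite: Gordon1997, Thm. 6.3 (3) and Corollary] -/
theorem AbelianVariety.isDivisorGenerated_powSucc_of_ribetTypeThirtyFiveFortyFour' (A : AbelianVariety ℂ) (φ : A ⟶ A)
    {d : ℕ} (hd : 0 < d) (hφ : φ ≫ φ = -(d • 𝟙 A)) (hE2 : Module.finrank ℚ A.endAlgebra = 2)
    (h44 : eigenMultiplicity A φ (Complex.I * (Real.sqrt d : ℂ)) = 44)
    (h35 : eigenMultiplicity A φ (-(Complex.I * (Real.sqrt d : ℂ))) = 35) (N : ℕ) :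
    IsDivisorGenerated (A.powSucc N) := by
  refine AbelianVariety.isDivisorGenerated_powSucc_of_ribetType_ofCoreSmul A φ hd hφ hE2 (by omega) (by omega) ?_ N
  intro W' _ _ _ 𝔊 ι P' Q' s hbr hirr hι hιι hP' hQ' hfinP' hfinQ' hadd hsmul hsymm hPQ hdefP hdefQ hadj
  exact UnitaryThirtyFiveFortyFour.eq_top_of_smul' hbr hirr hι hιι hP' hQ' (by rw [hfinP', h44]) (by rw [hfinQ', h35])
    hadd hsmul hsymm hPQ hdefP hdefQ hadj

/-- **The Hodge conjecture for all powers `A^{N+1}` of an abelian variety of Ribet type `(35, 44)` — UNCONDITIONAL.**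
[cite: Ribet1983, Thm. 3] [cite: Deligne2000, §1] -/
theorem hodgeConjectureFor_powSucc_of_ribetTypeThirtyFiveFortyFour (A : AbelianVariety ℂ) (φ : A ⟶ A)
    {d : ℕ} (hd : 0 < d) (hφ : φ ≫ φ = -(d • 𝟙 A)) (hE2 : Module.finrank ℚ A.endAlgebra = 2)
    (h35 : eigenMultiplicity A φ (Complex.I * (Real.sqrt d : ℂ)) = 35)
    (h44 : eigenMultiplicity A φ (-(Complex.I * (Real.sqrt d : ℂ))) = 44) (N : ℕ) :
    HodgeConjectureFor (A.powSucc N).dim (A.powSucc N).X :=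
  hodgeConjectureFor_of_isDivisorGenerated _
    (AbelianVariety.isDivisorGenerated_powSucc_of_ribetTypeThirtyFiveFortyFour A φ hd hφ hE2 h35 h44 N)

/-- **79-FOLDS of signature `{35, 44}`: `B• = D•` on all powers — UNCONDITIONAL** (either eigenvalue may carry the `35`).
[cite: Ribet1983, Thm. 0 and Thm. 3] [cite: MoonenZarhin1999LowDim, §2 (2.4)] -/
theorem AbelianVariety.isDivisorGenerated_powSucc_of_seventyninefold_thirtyFiveFortyFour (A : AbelianVariety ℂ)
    (φ : A ⟶ A) {d : ℕ} (hd : 0 < d) (hφ : φ ≫ φ = -(d • 𝟙 A)) (hE2 : Module.finrank ℚ A.endAlgebra = 2)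
    (hX : A.dim = 79)
    (h35 : eigenMultiplicity A φ (Complex.I * (Real.sqrt d : ℂ)) = 35 ∨
      eigenMultiplicity A φ (-(Complex.I * (Real.sqrt d : ℂ))) = 35)
    (N : ℕ) : IsDivisorGenerated (A.powSucc N) := by
  have hsum := eigenMultiplicity_add_eigenMultiplicity_neg_eq_dim A φ hd hφ
  rw [hX] at hsum
  rcases h35 with h | h
  · exact AbelianVariety.isDivisorGenerated_powSucc_of_ribetTypeThirtyFiveFortyFour A φ hd hφ hE2 h (by omega) N
  · exact AbelianVariety.isDivisorGenerated_powSucc_of_ribetTypeThirtyFiveFortyFour' A φ hd hφ hE2 (by omega) h N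

/-- **The Hodge conjecture for all powers of a 79-FOLD of signature `{35, 44}` — UNCONDITIONAL.**
[cite: Ribet1983, Thm. 3] [cite: Deligne2000, §1] -/
theorem hodgeConjectureFor_powSucc_of_seventyninefold_thirtyFiveFortyFour (A : AbelianVariety ℂ)
    (φ : A ⟶ A) {d : ℕ} (hd : 0 < d) (hφ : φ ≫ φ = -(d • 𝟙 A)) (hE2 : Module.finrank ℚ A.endAlgebra = 2)
    (hX : A.dim = 79)
    (h35 : eigenMultiplicity A φ (Complex.I * (Real.sqrt d : ℂ)) = 35 ∨
      eigenMultiplicity A φ (-(Complex.I * (Real.sqrt d : ℂ))) = 35)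
    (N : ℕ) : HodgeConjectureFor (A.powSucc N).dim (A.powSucc N).X :=
  hodgeConjectureFor_of_isDivisorGenerated _
    (AbelianVariety.isDivisorGenerated_powSucc_of_seventyninefold_thirtyFiveFortyFour A φ hd hφ hE2 hX h35 N)

/-- **Ribet 1983 Thm. 3 at `(n′, n″) = (37, 42)` — UNCONDITIONAL** (core `UnitaryThirtySevenFortyTwo.eq_top_of_smul`).
[cite: Ribet1983, Thm. 0 and Thm. 3] [cite: Gordon1997, Thm. 6.3 (3) and Corollary] -/
theorem AbelianVariety.isDivisorGenerated_powSucc_of_ribetTypeThirtySevenFortyTwo (A : AbelianVariety ℂ) (φ : A ⟶ A)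
    {d : ℕ} (hd : 0 < d) (hφ : φ ≫ φ = -(d • 𝟙 A)) (hE2 : Module.finrank ℚ A.endAlgebra = 2)
    (h37 : eigenMultiplicity A φ (Complex.I * (Real.sqrt d : ℂ)) = 37)
    (h42 : eigenMultiplicity A φ (-(Complex.I * (Real.sqrt d : ℂ))) = 42) (N : ℕ) :
    IsDivisorGenerated (A.powSucc N) := by
  refine AbelianVariety.isDivisorGenerated_powSucc_of_ribetType_ofCoreSmul A φ hd hφ hE2 (by omega) (by omega) ?_ N
  intro W' _ _ _ 𝔊 ι P' Q' s hbr hirr hι hιι hP' hQ' hfinP' hfinQ' hadd hsmul hsymm hPQ hdefP hdefQ hadj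
  exact UnitaryThirtySevenFortyTwo.eq_top_of_smul hbr hirr hι hιι hP' hQ' (by rw [hfinP', h37]) (by rw [hfinQ', h42]) hadd
    hsmul hsymm hPQ hdefP hdefQ hadj

/-- The mirror: `n_{i√d}(φ) = 42`, `n_{−i√d}(φ) = 37` (core `UnitaryThirtySevenFortyTwo.eq_top_of_smul'`).
[cite: Ribet1983, Thm. 0 and Thm. 3] [cite: Gordon1997, Thm. 6.3 (3) and Corollary] -/
theorem AbelianVariety.isDivisorGenerated_powSucc_of_ribetTypeThirtySevenFortyTwo' (A : AbelianVariety ℂ) (φ : A ⟶ A)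
    {d : ℕ} (hd : 0 < d) (hφ : φ ≫ φ = -(d • 𝟙 A)) (hE2 : Module.finrank ℚ A.endAlgebra = 2)
    (h42 : eigenMultiplicity A φ (Complex.I * (Real.sqrt d : ℂ)) = 42)
    (h37 : eigenMultiplicity A φ (-(Complex.I * (Real.sqrt d : ℂ))) = 37) (N : ℕ) :
    IsDivisorGenerated (A.powSucc N) := by
  refine AbelianVariety.isDivisorGenerated_powSucc_of_ribetType_ofCoreSmul A φ hd hφ hE2 (by omega) (by omega) ?_ N
  intro W' _ _ _ 𝔊 ι P' Q' s hbr hirr hι hιι hP' hQ' hfinP' hfinQ' hadd hsmul hsymm hPQ hdefP hdefQ hadj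
  exact UnitaryThirtySevenFortyTwo.eq_top_of_smul' hbr hirr hι hιι hP' hQ' (by rw [hfinP', h42]) (by rw [hfinQ', h37])
    hadd hsmul hsymm hPQ hdefP hdefQ hadj

/-- **The Hodge conjecture for all powers `A^{N+1}` of an abelian variety of Ribet type `(37, 42)` — UNCONDITIONAL.**
[cite: Ribet1983, Thm. 3] [cite: Deligne2000, §1] -/
theorem hodgeConjectureFor_powSucc_of_ribetTypeThirtySevenFortyTwo (A : AbelianVariety ℂ) (φ : A ⟶ A)
    {d : ℕ} (hd : 0 < d) (hφ : φ ≫ φ = -(d • 𝟙 A)) (hE2 : Module.finrank ℚ A.endAlgebra = 2)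
    (h37 : eigenMultiplicity A φ (Complex.I * (Real.sqrt d : ℂ)) = 37)
    (h42 : eigenMultiplicity A φ (-(Complex.I * (Real.sqrt d : ℂ))) = 42) (N : ℕ) :
    HodgeConjectureFor (A.powSucc N).dim (A.powSucc N).X :=
  hodgeConjectureFor_of_isDivisorGenerated _
    (AbelianVariety.isDivisorGenerated_powSucc_of_ribetTypeThirtySevenFortyTwo A φ hd hφ hE2 h37 h42 N)

/-- **79-FOLDS of signature `{37, 42}`: `B• = D•` on all powers — UNCONDITIONAL** (either eigenvalue may carry the `37`).
[cite: Ribet1983, Thm. 0 and Thm. 3] [cite: MoonenZarhin1999LowDim, §2 (2.4)] -/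
theorem AbelianVariety.isDivisorGenerated_powSucc_of_seventyninefold_thirtySevenFortyTwo (A : AbelianVariety ℂ)
    (φ : A ⟶ A) {d : ℕ} (hd : 0 < d) (hφ : φ ≫ φ = -(d • 𝟙 A)) (hE2 : Module.finrank ℚ A.endAlgebra = 2)
    (hX : A.dim = 79)
    (h37 : eigenMultiplicity A φ (Complex.I * (Real.sqrt d : ℂ)) = 37 ∨
      eigenMultiplicity A φ (-(Complex.I * (Real.sqrt d : ℂ))) = 37)
    (N : ℕ) : IsDivisorGenerated (A.powSucc N) := by
  have hsum := eigenMultiplicity_add_eigenMultiplicity_neg_eq_dim A φ hd hφ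
  rw [hX] at hsum
  rcases h37 with h | h
  · exact AbelianVariety.isDivisorGenerated_powSucc_of_ribetTypeThirtySevenFortyTwo A φ hd hφ hE2 h (by omega) N
  · exact AbelianVariety.isDivisorGenerated_powSucc_of_ribetTypeThirtySevenFortyTwo' A φ hd hφ hE2 (by omega) h N

/-- **The Hodge conjecture for all powers of a 79-FOLD of signature `{37, 42}` — UNCONDITIONAL.**
[cite: Ribet1983, Thm. 3] [cite: Deligne2000, §1] -/
theorem hodgeConjectureFor_powSucc_of_seventyninefold_thirtySevenFortyTwo (A : AbelianVariety ℂ)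
    (φ : A ⟶ A) {d : ℕ} (hd : 0 < d) (hφ : φ ≫ φ = -(d • 𝟙 A)) (hE2 : Module.finrank ℚ A.endAlgebra = 2)
    (hX : A.dim = 79)
    (h37 : eigenMultiplicity A φ (Complex.I * (Real.sqrt d : ℂ)) = 37 ∨
      eigenMultiplicity A φ (-(Complex.I * (Real.sqrt d : ℂ))) = 37)
    (N : ℕ) : HodgeConjectureFor (A.powSucc N).dim (A.powSucc N).X :=
  hodgeConjectureFor_of_isDivisorGenerated _
    (AbelianVariety.isDivisorGenerated_powSucc_of_seventyninefold_thirtySevenFortyTwo A φ hd hφ hE2 hX h37 N)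

/-- **Ribet 1983 Thm. 3 at `(n′, n″) = (39, 40)` — UNCONDITIONAL** (core `UnitaryThirtyNineForty.eq_top_of_smul`).
[cite: Ribet1983, Thm. 0 and Thm. 3] [cite: Gordon1997, Thm. 6.3 (3) and Corollary] -/
theorem AbelianVariety.isDivisorGenerated_powSucc_of_ribetTypeThirtyNineForty (A : AbelianVariety ℂ) (φ : A ⟶ A)
    {d : ℕ} (hd : 0 < d) (hφ : φ ≫ φ = -(d • 𝟙 A)) (hE2 : Module.finrank ℚ A.endAlgebra = 2)
    (h39 : eigenMultiplicity A φ (Complex.I * (Real.sqrt d : ℂ)) = 39)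
    (h40 : eigenMultiplicity A φ (-(Complex.I * (Real.sqrt d : ℂ))) = 40) (N : ℕ) :
    IsDivisorGenerated (A.powSucc N) := by
  refine AbelianVariety.isDivisorGenerated_powSucc_of_ribetType_ofCoreSmul A φ hd hφ hE2 (by omega) (by omega) ?_ N
  intro W' _ _ _ 𝔊 ι P' Q' s hbr hirr hι hιι hP' hQ' hfinP' hfinQ' hadd hsmul hsymm hPQ hdefP hdefQ hadj
  exact UnitaryThirtyNineForty.eq_top_of_smul hbr hirr hι hιι hP' hQ' (by rw [hfinP', h39]) (by rw [hfinQ', h40]) hadd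
    hsmul hsymm hPQ hdefP hdefQ hadj

/-- The mirror: `n_{i√d}(φ) = 40`, `n_{−i√d}(φ) = 39` (core `UnitaryThirtyNineForty.eq_top_of_smul'`).
[cite: Ribet1983, Thm. 0 and Thm. 3] [cite: Gordon1997, Thm. 6.3 (3) and Corollary] -/
theorem AbelianVariety.isDivisorGenerated_powSucc_of_ribetTypeThirtyNineForty' (A : AbelianVariety ℂ) (φ : A ⟶ A)
    {d : ℕ} (hd : 0 < d) (hφ : φ ≫ φ = -(d • 𝟙 A)) (hE2 : Module.finrank ℚ A.endAlgebra = 2)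
    (h40 : eigenMultiplicity A φ (Complex.I * (Real.sqrt d : ℂ)) = 40)
    (h39 : eigenMultiplicity A φ (-(Complex.I * (Real.sqrt d : ℂ))) = 39) (N : ℕ) :
    IsDivisorGenerated (A.powSucc N) := by
  refine AbelianVariety.isDivisorGenerated_powSucc_of_ribetType_ofCoreSmul A φ hd hφ hE2 (by omega) (by omega) ?_ N
  intro W' _ _ _ 𝔊 ι P' Q' s hbr hirr hι hιι hP' hQ' hfinP' hfinQ' hadd hsmul hsymm hPQ hdefP hdefQ hadj
  exact UnitaryThirtyNineForty.eq_top_of_smul' hbr hirr hι hιι hP' hQ' (by rw [hfinP', h40]) (by rw [hfinQ', h39])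
    hadd hsmul hsymm hPQ hdefP hdefQ hadj

/-- **The Hodge conjecture for all powers `A^{N+1}` of an abelian variety of Ribet type `(39, 40)` — UNCONDITIONAL.**
[cite: Ribet1983, Thm. 3] [cite: Deligne2000, §1] -/
theorem hodgeConjectureFor_powSucc_of_ribetTypeThirtyNineForty (A : AbelianVariety ℂ) (φ : A ⟶ A)
    {d : ℕ} (hd : 0 < d) (hφ : φ ≫ φ = -(d • 𝟙 A)) (hE2 : Module.finrank ℚ A.endAlgebra = 2)
    (h39 : eigenMultiplicity A φ (Complex.I * (Real.sqrt d : ℂ)) = 39)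
    (h40 : eigenMultiplicity A φ (-(Complex.I * (Real.sqrt d : ℂ))) = 40) (N : ℕ) :
    HodgeConjectureFor (A.powSucc N).dim (A.powSucc N).X :=
  hodgeConjectureFor_of_isDivisorGenerated _
    (AbelianVariety.isDivisorGenerated_powSucc_of_ribetTypeThirtyNineForty A φ hd hφ hE2 h39 h40 N)

/-- **79-FOLDS of signature `{39, 40}`: `B• = D•` on all powers — UNCONDITIONAL** (either eigenvalue may carry the `39`).
[cite: Ribet1983, Thm. 0 and Thm. 3] [cite: MoonenZarhin1999LowDim, §2 (2.4)] -/
theorem AbelianVariety.isDivisorGenerated_powSucc_of_seventyninefold_thirtyNineForty (A : AbelianVariety ℂ)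
    (φ : A ⟶ A) {d : ℕ} (hd : 0 < d) (hφ : φ ≫ φ = -(d • 𝟙 A)) (hE2 : Module.finrank ℚ A.endAlgebra = 2)
    (hX : A.dim = 79)
    (h39 : eigenMultiplicity A φ (Complex.I * (Real.sqrt d : ℂ)) = 39 ∨
      eigenMultiplicity A φ (-(Complex.I * (Real.sqrt d : ℂ))) = 39)
    (N : ℕ) : IsDivisorGenerated (A.powSucc N) := by
  have hsum := eigenMultiplicity_add_eigenMultiplicity_neg_eq_dim A φ hd hφ
  rw [hX] at hsum
  rcases h39 with h | h
  · exact AbelianVariety.isDivisorGenerated_powSucc_of_ribetTypeThirtyNineForty A φ hd hφ hE2 h (by omega) N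
  · exact AbelianVariety.isDivisorGenerated_powSucc_of_ribetTypeThirtyNineForty' A φ hd hφ hE2 (by omega) h N

/-- **The Hodge conjecture for all powers of a 79-FOLD of signature `{39, 40}` — UNCONDITIONAL.**
[cite: Ribet1983, Thm. 3] [cite: Deligne2000, §1] -/
theorem hodgeConjectureFor_powSucc_of_seventyninefold_thirtyNineForty (A : AbelianVariety ℂ)
    (φ : A ⟶ A) {d : ℕ} (hd : 0 < d) (hφ : φ ≫ φ = -(d • 𝟙 A)) (hE2 : Module.finrank ℚ A.endAlgebra = 2)
    (hX : A.dim = 79)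
    (h39 : eigenMultiplicity A φ (Complex.I * (Real.sqrt d : ℂ)) = 39 ∨
      eigenMultiplicity A φ (-(Complex.I * (Real.sqrt d : ℂ))) = 39)
    (N : ℕ) : HodgeConjectureFor (A.powSucc N).dim (A.powSucc N).X :=
  hodgeConjectureFor_of_isDivisorGenerated _
    (AbelianVariety.isDivisorGenerated_powSucc_of_seventyninefold_thirtyNineForty A φ hd hφ hE2 hX h39 N)

end Cells

/-! ### §2 Every simple complex abelian 79-fold with `End⁰ ≠ ℚ` -/

section Final

variable {X : AbelianVariety ℂ}

/-- **`B• = D•` on all powers of a SIMPLE complex abelian `79`-FOLD, granted ONLY the shape `End⁰ = ℚ`.** (The census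
`isDivisorGenerated_powSucc_of_isSimple_seventyninefold` with all its imaginary-quadratic inputs, the `k`-signatures
`{9, 70}`, `{10, 69}`, `{14, 65}`, `{15, 64}`, `{16, 63}`, `{17, 62}`, `{19, 60}`, `{21, 58}`, `{22, 57}`, `{23, 56}`, `{24, 55}`, `{25, 54}`, `{27, 52}`, `{28, 51}`, `{29, 50}`, `{30, 49}`, `{31, 48}`, `{33, 46}`, `{34, 45}`, `{35, 44}`, `{37, 42}`, `{39, 40}`, supplied by §1.)
[cite: MoonenZarhin1999LowDim, §2 (2.4) and Thm. (2.7)] [cite: Ribet1983, Thms. 0–3] [cite: Gordon1997, Thm. 6.3 and Corollary] -/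
theorem isDivisorGenerated_powSucc_of_isSimple_seventyninefold' (hs : X.IsSimple) (hX : X.dim = 79)
    (h1 : Module.finrank ℚ X.endAlgebra = 1 → ∀ N : ℕ, IsDivisorGenerated (X.powSucc N)) (N : ℕ) :
    IsDivisorGenerated (X.powSucc N) := by
  refine isDivisorGenerated_powSucc_of_isSimple_seventyninefold hs hX h1 (fun φ d hd hφ he2 h N => ?_) N
  have hsum := eigenMultiplicity_add_eigenMultiplicity_neg_eq_dim X φ hd hφ
  rw [hX] at hsum
  by_cases h9 : eigenMultiplicity X φ (Complex.I * (Real.sqrt d : ℂ)) = 9 ∨ eigenMultiplicity X φ (-(Complex.I * (Real.sqrt d : ℂ))) = 9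
  · exact AbelianVariety.isDivisorGenerated_powSucc_of_seventyninefold_nineSeventy X φ hd hφ he2 hX h9 N
  by_cases h10 : eigenMultiplicity X φ (Complex.I * (Real.sqrt d : ℂ)) = 10 ∨ eigenMultiplicity X φ (-(Complex.I * (Real.sqrt d : ℂ))) = 10
  · exact AbelianVariety.isDivisorGenerated_powSucc_of_seventyninefold_tenSixtyNine X φ hd hφ he2 hX h10 N
  by_cases h14 : eigenMultiplicity X φ (Complex.I * (Real.sqrt d : ℂ)) = 14 ∨ eigenMultiplicity X φ (-(Complex.I * (Real.sqrt d : ℂ))) = 14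
  · exact AbelianVariety.isDivisorGenerated_powSucc_of_seventyninefold_fourteenSixtyFive X φ hd hφ he2 hX h14 N
  by_cases h15 : eigenMultiplicity X φ (Complex.I * (Real.sqrt d : ℂ)) = 15 ∨ eigenMultiplicity X φ (-(Complex.I * (Real.sqrt d : ℂ))) = 15
  · exact AbelianVariety.isDivisorGenerated_powSucc_of_seventyninefold_fifteenSixtyFour X φ hd hφ he2 hX h15 N
  by_cases h16 : eigenMultiplicity X φ (Complex.I * (Real.sqrt d : ℂ)) = 16 ∨ eigenMultiplicity X φ (-(Complex.I * (Real.sqrt d : ℂ))) = 16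
  · exact AbelianVariety.isDivisorGenerated_powSucc_of_seventyninefold_sixteenSixtyThree X φ hd hφ he2 hX h16 N
  by_cases h17 : eigenMultiplicity X φ (Complex.I * (Real.sqrt d : ℂ)) = 17 ∨ eigenMultiplicity X φ (-(Complex.I * (Real.sqrt d : ℂ))) = 17
  · exact AbelianVariety.isDivisorGenerated_powSucc_of_seventyninefold_seventeenSixtyTwo X φ hd hφ he2 hX h17 N
  by_cases h19 : eigenMultiplicity X φ (Complex.I * (Real.sqrt d : ℂ)) = 19 ∨ eigenMultiplicity X φ (-(Complex.I * (Real.sqrt d : ℂ))) = 19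
  · exact AbelianVariety.isDivisorGenerated_powSucc_of_seventyninefold_nineteenSixty X φ hd hφ he2 hX h19 N
  by_cases h21 : eigenMultiplicity X φ (Complex.I * (Real.sqrt d : ℂ)) = 21 ∨ eigenMultiplicity X φ (-(Complex.I * (Real.sqrt d : ℂ))) = 21
  · exact AbelianVariety.isDivisorGenerated_powSucc_of_seventyninefold_twentyOneFiftyEight X φ hd hφ he2 hX h21 N
  by_cases h22 : eigenMultiplicity X φ (Complex.I * (Real.sqrt d : ℂ)) = 22 ∨ eigenMultiplicity X φ (-(Complex.I * (Real.sqrt d : ℂ))) = 22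
  · exact AbelianVariety.isDivisorGenerated_powSucc_of_seventyninefold_twentyTwoFiftySeven X φ hd hφ he2 hX h22 N
  by_cases h23 : eigenMultiplicity X φ (Complex.I * (Real.sqrt d : ℂ)) = 23 ∨ eigenMultiplicity X φ (-(Complex.I * (Real.sqrt d : ℂ))) = 23
  · exact AbelianVariety.isDivisorGenerated_powSucc_of_seventyninefold_twentyThreeFiftySix X φ hd hφ he2 hX h23 N
  by_cases h24 : eigenMultiplicity X φ (Complex.I * (Real.sqrt d : ℂ)) = 24 ∨ eigenMultiplicity X φ (-(Complex.I * (Real.sqrt d : ℂ))) = 24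
  · exact AbelianVariety.isDivisorGenerated_powSucc_of_seventyninefold_twentyFourFiftyFive X φ hd hφ he2 hX h24 N
  by_cases h25 : eigenMultiplicity X φ (Complex.I * (Real.sqrt d : ℂ)) = 25 ∨ eigenMultiplicity X φ (-(Complex.I * (Real.sqrt d : ℂ))) = 25
  · exact AbelianVariety.isDivisorGenerated_powSucc_of_seventyninefold_twentyFiveFiftyFour X φ hd hφ he2 hX h25 N
  by_cases h27 : eigenMultiplicity X φ (Complex.I * (Real.sqrt d : ℂ)) = 27 ∨ eigenMultiplicity X φ (-(Complex.I * (Real.sqrt d : ℂ))) = 27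
  · exact AbelianVariety.isDivisorGenerated_powSucc_of_seventyninefold_twentySevenFiftyTwo X φ hd hφ he2 hX h27 N
  by_cases h28 : eigenMultiplicity X φ (Complex.I * (Real.sqrt d : ℂ)) = 28 ∨ eigenMultiplicity X φ (-(Complex.I * (Real.sqrt d : ℂ))) = 28
  · exact AbelianVariety.isDivisorGenerated_powSucc_of_seventyninefold_twentyEightFiftyOne X φ hd hφ he2 hX h28 N
  by_cases h29 : eigenMultiplicity X φ (Complex.I * (Real.sqrt d : ℂ)) = 29 ∨ eigenMultiplicity X φ (-(Complex.I * (Real.sqrt d : ℂ))) = 29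
  · exact AbelianVariety.isDivisorGenerated_powSucc_of_seventyninefold_twentyNineFifty X φ hd hφ he2 hX h29 N
  by_cases h30 : eigenMultiplicity X φ (Complex.I * (Real.sqrt d : ℂ)) = 30 ∨ eigenMultiplicity X φ (-(Complex.I * (Real.sqrt d : ℂ))) = 30
  · exact AbelianVariety.isDivisorGenerated_powSucc_of_seventyninefold_thirtyFortyNine X φ hd hφ he2 hX h30 N
  by_cases h31 : eigenMultiplicity X φ (Complex.I * (Real.sqrt d : ℂ)) = 31 ∨ eigenMultiplicity X φ (-(Complex.I * (Real.sqrt d : ℂ))) = 31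
  · exact AbelianVariety.isDivisorGenerated_powSucc_of_seventyninefold_thirtyOneFortyEight X φ hd hφ he2 hX h31 N
  by_cases h33 : eigenMultiplicity X φ (Complex.I * (Real.sqrt d : ℂ)) = 33 ∨ eigenMultiplicity X φ (-(Complex.I * (Real.sqrt d : ℂ))) = 33
  · exact AbelianVariety.isDivisorGenerated_powSucc_of_seventyninefold_thirtyThreeFortySix X φ hd hφ he2 hX h33 N
  by_cases h34 : eigenMultiplicity X φ (Complex.I * (Real.sqrt d : ℂ)) = 34 ∨ eigenMultiplicity X φ (-(Complex.I * (Real.sqrt d : ℂ))) = 34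
  · exact AbelianVariety.isDivisorGenerated_powSucc_of_seventyninefold_thirtyFourFortyFive X φ hd hφ he2 hX h34 N
  by_cases h35 : eigenMultiplicity X φ (Complex.I * (Real.sqrt d : ℂ)) = 35 ∨ eigenMultiplicity X φ (-(Complex.I * (Real.sqrt d : ℂ))) = 35
  · exact AbelianVariety.isDivisorGenerated_powSucc_of_seventyninefold_thirtyFiveFortyFour X φ hd hφ he2 hX h35 N
  by_cases h37 : eigenMultiplicity X φ (Complex.I * (Real.sqrt d : ℂ)) = 37 ∨ eigenMultiplicity X φ (-(Complex.I * (Real.sqrt d : ℂ))) = 37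
  · exact AbelianVariety.isDivisorGenerated_powSucc_of_seventyninefold_thirtySevenFortyTwo X φ hd hφ he2 hX h37 N
  by_cases h39 : eigenMultiplicity X φ (Complex.I * (Real.sqrt d : ℂ)) = 39 ∨ eigenMultiplicity X φ (-(Complex.I * (Real.sqrt d : ℂ))) = 39
  · exact AbelianVariety.isDivisorGenerated_powSucc_of_seventyninefold_thirtyNineForty X φ hd hφ he2 hX h39 N
  omega

/-- **`B• = D•` on all powers of EVERY SIMPLE complex abelian `79`-FOLD with `End⁰ ≠ ℚ` — UNCONDITIONAL.**
[cite: MoonenZarhin1999LowDim, §2 (2.4) and Thm. (2.7)] [cite: Ribet1983, Thms. 0–3] -/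
theorem isDivisorGenerated_powSucc_of_isSimple_seventyninefold_of_finrank_endAlgebra_ne_one (hs : X.IsSimple)
    (hX : X.dim = 79) (hne : Module.finrank ℚ X.endAlgebra ≠ 1) (N : ℕ) : IsDivisorGenerated (X.powSucc N) :=
  isDivisorGenerated_powSucc_of_isSimple_seventyninefold' hs hX (fun h => absurd h hne) N

/-- **The Hodge conjecture for all powers of EVERY SIMPLE complex abelian `79`-FOLD with `End⁰ ≠ ℚ` —
UNCONDITIONAL.** [cite: MoonenZarhin1999LowDim, §2 Thm. (2.7)] [cite: Ribet1983, Thm. 3] [cite: Deligne2000, §1] -/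
theorem hodgeConjectureFor_powSucc_of_isSimple_seventyninefold_of_finrank_endAlgebra_ne_one (hs : X.IsSimple)
    (hX : X.dim = 79) (hne : Module.finrank ℚ X.endAlgebra ≠ 1) (N : ℕ) :
    HodgeConjectureFor (X.powSucc N).dim (X.powSucc N).X :=
  hodgeConjectureFor_of_isDivisorGenerated _
    (isDivisorGenerated_powSucc_of_isSimple_seventyninefold_of_finrank_endAlgebra_ne_one hs hX hne N)

end Final

end Literature.AlgebraicGeometry.HodgeTheory

end

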